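import Mathlib
import HarnessLib

/-!
# The depolarisation identity of §4.5 (pp. 18–19): `Σ_r K_{1,r}(F) = ∫₀¹ F'²`

Trunk AntSieve, tooling toward the named fact `Literature.NumberTheory.Sieve.weakDHL_three_two_of_GEH`
(D. H. J. Polymath, Res. Math. Sci. 1:12 (2014) = arXiv:1407.4897, Theorem 3.2(xii)).

§4.5, pp. 18–19: the constant `c''_ε` of the truncated inner sum converges, as `ε → 0`, to
`∫₀¹ F'_k G'_k`.  The paper proves the identity (depol)
`Σ_{r>0} ∫_{0<t₁<…<t_r, Σ tᵢ = 1} |∂_{(t₁)}⋯∂_{(t_r)} F(0)|² dt/(t₁⋯t_r) = ∫₀¹ |F'|²` through the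
quantities `I_a(F) = ∫₀^a F'²`, `J_a(F) = (∂_{(a)}F(0))²`, `K_{a,r}(F)`, `L_{a,k}(F)` and the identity
`I_a(F) = J_a(F)/a + ∫₀^a I_{a-t}(∂_{(t)} F) dt/a` (p. 18).  We formalise everything RECURSIVELY in the
number of peeled variables (no explicit simplices): with `∂_{(t)}F = F(· + t) - F` (`fdiff`),

* `Kfun 0 a F = J_a(F)/a`, `Kfun (r+1) a F = (1/a) ∫₀^a Kfun r (a - t) (∂_{(t)} F) dt` (= `K_{a,r+1}`);
* `Lfun 0 a F = I_a(F)`, `Lfun (k+1) a F = (1/a) ∫₀^a Lfun k (a - t) (∂_{(t)} F) dt` (= `L_{a,k}`… shifted);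
* `Mfun ε` — the same as `Kfun` with all variables `≥ ε` (the truncated constant `c''_ε` is
  `Σ_{r ≤ 1/ε} Mfun ε r 1`).

This first file sets up the objects, their linearity, bounds, continuity and measurability along
the families `∂_{(s₁)}⋯∂_{(s_j)} F` (`dIterV`), for `F` of class `C²` with bounded first and second
derivatives (`NiceFun`).

## References

* [Polymath8b2014] D. H. J. Polymath, Res. Math. Sci. 1 (2014), Art. 12 = arXiv:1407.4897,
  §4.5, pp. 18–19 (depol), (iak), (krsum).
-/

noncomputable section

open MeasureTheory Set Filter intervalIntegral
open scoped Topology Interval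

namespace Literature.NumberTheory.Sieve

namespace Depol

/-! ### Finite differences -/

/-- `∂_{(t)} F (u) = F(u + t) - F(u)`. [cite: Polymath8b2014, §4.5, p. 18] -/
def fdiff (t : ℝ) (F : ℝ → ℝ) : ℝ → ℝ := fun u => F (u + t) - F u

/-- Unfolding `∂_{(t)}F`. [folklore] -/
@[simp] theorem fdiff_apply (t : ℝ) (F : ℝ → ℝ) (u : ℝ) : fdiff t F u = F (u + t) - F u := rfl

/-- `∂_{(t)}` is additive. [folklore] -/
theorem fdiff_add (t : ℝ) (F G : ℝ → ℝ) : fdiff t (F + G) = fdiff t F + fdiff t G := by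
  funext u; simp [fdiff]; ring

/-- `∂_{(t)}` respects subtraction. [folklore] -/
theorem fdiff_sub (t : ℝ) (F G : ℝ → ℝ) : fdiff t (F - G) = fdiff t F - fdiff t G := by
  funext u; simp [fdiff]; ring

/-- The iterated difference along a parameter vector: `∂_{(s₀)} ∂_{(s₁)} ⋯ F`. [folklore] -/
def dIterV : (j : ℕ) → (Fin j → ℝ) → (ℝ → ℝ) → ℝ → ℝ
  | 0, _, F => F
  | j + 1, s, F => fdiff (s 0) (dIterV j (Fin.tail s) F)

/-- No differences. [folklore] -/
@[simp] theorem dIterV_zero (s : Fin 0 → ℝ) (F : ℝ → ℝ) : dIterV 0 s F = F := rfl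

/-- One more difference (recursion). [folklore] -/
theorem dIterV_succ {j : ℕ} (s : Fin (j + 1) → ℝ) (F : ℝ → ℝ) :
    dIterV (j + 1) s F = fdiff (s 0) (dIterV j (Fin.tail s) F) := rfl

/-- One more difference, `Fin.cons` form. [folklore] -/
theorem dIterV_cons {j : ℕ} (t : ℝ) (s : Fin j → ℝ) (F : ℝ → ℝ) :
    dIterV (j + 1) (Fin.cons t s) F = fdiff t (dIterV j s F) := by
  rw [dIterV_succ, Fin.cons_zero, Fin.tail_cons]

/-! ### The regularity class -/

/-- `F ∈ C²` with `|F'|, |F''| ≤ D`. [folklore] -/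
structure NiceFun (F : ℝ → ℝ) (D : ℝ) : Prop where
  contDiff : ContDiff ℝ 2 F
  bound1 : ∀ t, |deriv F t| ≤ D
  bound2 : ∀ t, |deriv (deriv F) t| ≤ D

namespace NiceFun

variable {F G : ℝ → ℝ} {D D' : ℝ}

/-- The constant is `≥ 0`. [folklore] -/
theorem nonneg (h : NiceFun F D) : 0 ≤ D := (abs_nonneg _).trans (h.bound1 0)

/-- Nice functions are differentiable. [folklore] -/
theorem differentiable (h : NiceFun F D) : Differentiable ℝ F :=
  h.contDiff.differentiable (by norm_num)

/-- Nice functions are continuous. [folklore] -/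
theorem continuous (h : NiceFun F D) : Continuous F := h.contDiff.continuous

/-- The derivative is `C¹`. [folklore] -/
theorem contDiff_one_deriv (h : NiceFun F D) : ContDiff ℝ 1 (deriv F) := by
  have := h.contDiff
  rw [show (2 : WithTop ℕ∞) = 1 + 1 by norm_num] at this
  exact (contDiff_succ_iff_deriv.1 this).2.2

/-- The derivative is differentiable. [folklore] -/
theorem differentiable_deriv (h : NiceFun F D) : Differentiable ℝ (deriv F) :=
  h.contDiff_one_deriv.differentiable one_ne_zero

/-- The derivative is continuous. [folklore] -/
theorem continuous_deriv (h : NiceFun F D) : Continuous (deriv F) := h.contDiff_one_deriv.continuous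

/-- The second derivative is continuous. [folklore] -/
theorem continuous_deriv2 (h : NiceFun F D) : Continuous (deriv (deriv F)) := by
  have := h.contDiff_one_deriv
  rw [show (1 : WithTop ℕ∞) = 0 + 1 by norm_num] at this
  exact (contDiff_succ_iff_deriv.1 this).2.2.continuous

/-- Mean value bound `|F(a) - F(b)| ≤ D |a - b|`. [folklore] -/
theorem abs_sub_le (h : NiceFun F D) (a b : ℝ) : |F a - F b| ≤ D * |a - b| := by
  have := Convex.norm_image_sub_le_of_norm_deriv_le (f := F) (s := Set.univ) (C := D)
    (fun x _ => h.differentiable.differentiableAt) (fun x _ => by rw [Real.norm_eq_abs]; exact h.bound1 x)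
    convex_univ (Set.mem_univ b) (Set.mem_univ a)
  rwa [Real.norm_eq_abs, Real.norm_eq_abs] at this

/-- The same for `F'`. [folklore] -/
theorem abs_deriv_sub_le (h : NiceFun F D) (a b : ℝ) : |deriv F a - deriv F b| ≤ D * |a - b| := by
  have := Convex.norm_image_sub_le_of_norm_deriv_le (f := deriv F) (s := Set.univ) (C := D)
    (fun x _ => h.differentiable_deriv.differentiableAt) (fun x _ => by rw [Real.norm_eq_abs]; exact h.bound2 x)
    convex_univ (Set.mem_univ b) (Set.mem_univ a)
  rwa [Real.norm_eq_abs, Real.norm_eq_abs] at this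

/-- Monotonicity in the constant. [folklore] -/
theorem mono (h : NiceFun F D) (hD : D ≤ D') : NiceFun F D' :=
  ⟨h.contDiff, fun t => (h.bound1 t).trans hD, fun t => (h.bound2 t).trans hD⟩

/-- Sums are nice. [folklore] -/
theorem add (hF : NiceFun F D) (hG : NiceFun G D') : NiceFun (F + G) (D + D') := by
  refine ⟨hF.contDiff.add hG.contDiff, fun t => ?_, fun t => ?_⟩
  · rw [deriv_add hF.differentiable.differentiableAt hG.differentiable.differentiableAt]
    exact (abs_add_le _ _).trans (add_le_add (hF.bound1 t) (hG.bound1 t))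
  · have h1 : deriv (F + G) = deriv F + deriv G := by
      funext u; exact deriv_add hF.differentiable.differentiableAt hG.differentiable.differentiableAt
    rw [h1, deriv_add hF.differentiable_deriv.differentiableAt hG.differentiable_deriv.differentiableAt]
    exact (abs_add_le _ _).trans (add_le_add (hF.bound2 t) (hG.bound2 t))

/-- Negatives are nice. [folklore] -/
theorem neg (hF : NiceFun F D) : NiceFun (-F) D := by
  refine ⟨hF.contDiff.neg, fun t => ?_, fun t => ?_⟩
  · rw [deriv.neg, abs_neg]; exact hF.bound1 t
  · have h1 : deriv (-F) = -deriv F := by funext u; exact deriv.neg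
    rw [h1, deriv.neg, abs_neg]; exact hF.bound2 t

/-- Differences are nice. [folklore] -/
theorem sub (hF : NiceFun F D) (hG : NiceFun G D') : NiceFun (F - G) (D + D') := by
  rw [sub_eq_add_neg]; exact hF.add hG.neg

/-- Translation invariance. [folklore] -/
theorem comp_add (hF : NiceFun F D) (t : ℝ) : NiceFun (fun u => F (u + t)) D := by
  have hd : deriv (fun u => F (u + t)) = fun u => deriv F (u + t) := by
    funext u; exact deriv_comp_add_const _ t u  -- `deriv (fun u => F (u + t)) u = deriv F (u + t)`
  refine ⟨hF.contDiff.comp (contDiff_id.add contDiff_const), fun u => ?_, fun u => ?_⟩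
  · rw [hd]; exact hF.bound1 _
  · rw [hd, deriv_comp_add_const (deriv F) t u]; exact hF.bound2 _

/-- `∂_{(t)}F` is nice with constant `2D`. [folklore] -/
theorem fdiff (hF : NiceFun F D) (t : ℝ) : NiceFun (fdiff t F) (D + D) := by
  have : Depol.fdiff t F = (fun u => F (u + t)) - F := rfl
  rw [this]; exact (hF.comp_add t).sub hF

/-- The derivative of `F`, for `F ∈ C³`-type input: here we only record that `deriv` commutes with
`fdiff`. [folklore] -/
theorem deriv_fdiff (hF : NiceFun F D) (t : ℝ) : deriv (Depol.fdiff t F) = Depol.fdiff t (deriv F) := by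
  funext u
  have : Depol.fdiff t F = (fun u => F (u + t)) - F := rfl
  rw [this, deriv_sub (hF.comp_add t).differentiable.differentiableAt hF.differentiable.differentiableAt,
    deriv_comp_add_const F t u]
  rfl

end NiceFun

/-- Iterated differences stay nice, constant `2^j D`. [folklore] -/
theorem niceFun_dIterV {F : ℝ → ℝ} {D : ℝ} (hF : NiceFun F D) :
    ∀ (j : ℕ) (s : Fin j → ℝ), NiceFun (dIterV j s F) (2 ^ j * D)
  | 0, s => by simpa using hF
  | j + 1, s => by
    rw [dIterV_succ, pow_succ, show 2 ^ j * 2 * D = 2 ^ j * D + 2 ^ j * D by ring]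
    exact (niceFun_dIterV hF j (Fin.tail s)).fdiff (s 0)

/-- Joint continuity of `(s, u) ↦ ∂_{(s)}⋯F(u)`. [folklore] -/
theorem continuous_dIterV {F : ℝ → ℝ} (hF : Continuous F) :
    ∀ j : ℕ, Continuous (fun p : (Fin j → ℝ) × ℝ => dIterV j p.1 F p.2)
  | 0 => hF.comp continuous_snd
  | j + 1 => by
    have ih := continuous_dIterV hF j
    simp only [dIterV_succ, fdiff_apply]
    refine Continuous.sub ?_ ?_
    · exact ih.comp (Continuous.prodMk ((continuous_apply_tail j).comp continuous_fst)
        (continuous_snd.add ((continuous_apply 0).comp continuous_fst)))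
    · exact ih.comp (Continuous.prodMk ((continuous_apply_tail j).comp continuous_fst) continuous_snd)
where
  continuous_apply_tail (j : ℕ) : Continuous (fun s : Fin (j + 1) → ℝ => Fin.tail s) :=
    continuous_pi fun i => continuous_apply i.succ

/-- `deriv` of an iterated difference is the iterated difference of `deriv`. [folklore] -/
theorem deriv_dIterV {F : ℝ → ℝ} {D : ℝ} (hF : NiceFun F D) :
    ∀ (j : ℕ) (s : Fin j → ℝ), deriv (dIterV j s F) = dIterV j s (deriv F)
  | 0, s => rfl
  | j + 1, s => by
    rw [dIterV_succ, dIterV_succ, (niceFun_dIterV hF j (Fin.tail s)).deriv_fdiff, deriv_dIterV hF j]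

/-- Translation `τ_u F = F(· + u)`. [folklore] -/
def translate (u : ℝ) (F : ℝ → ℝ) : ℝ → ℝ := fun v => F (v + u)

/-- Unfolding the translation. [folklore] -/
@[simp] theorem translate_apply (u : ℝ) (F : ℝ → ℝ) (v : ℝ) : translate u F v = F (v + u) := rfl

/-- Translates are nice. [folklore] -/
theorem NiceFun.translate {F : ℝ → ℝ} {D : ℝ} (hF : NiceFun F D) (u : ℝ) : NiceFun (translate u F) D :=
  hF.comp_add u

/-- Differences commute with translation. [folklore] -/
theorem dIterV_translate (F : ℝ → ℝ) (u : ℝ) :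
    ∀ (j : ℕ) (s : Fin j → ℝ) (v : ℝ), dIterV j s (translate u F) v = dIterV j s F (v + u)
  | 0, s, v => rfl
  | j + 1, s, v => by
    simp only [dIterV_succ, fdiff_apply, dIterV_translate F u j (Fin.tail s)]
    ring_nf

/-- `deriv` commutes with translation. [folklore] -/
theorem deriv_translate (F : ℝ → ℝ) (u : ℝ) :
    deriv (translate u F) = translate u (deriv F) := by
  funext v; exact deriv_comp_add_const F u v

/-- Joint continuity of `(s, u, v) ↦ ∂_{(s)}⋯(τ_u F)(v)`. [folklore] -/
theorem continuous_dIterV_translate {F : ℝ → ℝ} (hF : Continuous F) (j : ℕ) :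
    Continuous (fun p : ((Fin j → ℝ) × ℝ) × ℝ => dIterV j p.1.1 (translate p.1.2 F) p.2) := by
  simp_rw [dIterV_translate]
  exact (continuous_dIterV hF j).comp (Continuous.prodMk (continuous_fst.comp continuous_fst)
    (continuous_snd.add (continuous_snd.comp continuous_fst)))

/-! ### A continuity lemma for quotients by the first coordinate -/

/-- If `g` is continuous and `|g(a, x)| ≤ C a²` then `g(a,x)/a` is continuous (value `0` at `a = 0`). [folklore] -/
theorem continuous_div_fst_of_bound {X : Type*} [TopologicalSpace X] {g : ℝ × X → ℝ} (hg : Continuous g)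
    {C : ℝ} (hb : ∀ p, |g p| ≤ C * p.1 ^ 2) : Continuous (fun p : ℝ × X => g p / p.1) := by
  rw [continuous_iff_continuousAt]
  rintro ⟨a, x⟩
  by_cases ha : a = 0
  · subst ha
    rw [ContinuousAt, div_zero]
    refine squeeze_zero_norm (a := fun p : ℝ × X => |C| * ‖p.1‖) (fun p => ?_) ?_
    · rw [Real.norm_eq_abs, Real.norm_eq_abs]
      by_cases hp : p.1 = 0
      · simp [hp]
      · rw [abs_div, div_le_iff₀ (abs_pos.2 hp)]
        calc |g p| ≤ C * p.1 ^ 2 := hb p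
          _ ≤ |C| * p.1 ^ 2 := mul_le_mul_of_nonneg_right (le_abs_self C) (sq_nonneg _)
          _ = |C| * |p.1| * |p.1| := by rw [mul_assoc, ← sq, sq_abs]
    · have : Tendsto (fun p : ℝ × X => |C| * ‖p.1‖) (𝓝 ((0 : ℝ), x)) (𝓝 (|C| * ‖(0 : ℝ)‖)) :=
        (continuous_const.mul (continuous_norm.comp continuous_fst)).continuousAt
      simpa using this
  · exact hg.continuousAt.div continuous_fst.continuousAt ha

/-- `Fin.cons` is continuous in both arguments. [folklore] -/
theorem continuous_finCons {j : ℕ} : Continuous (fun q : ℝ × (Fin j → ℝ) => (Fin.cons q.1 q.2 : Fin (j + 1) → ℝ)) := by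
  refine continuous_pi fun i => ?_
  refine Fin.cases ?_ (fun i => ?_) i
  · simpa using continuous_fst
  · have : (fun q : ℝ × (Fin j → ℝ) => (Fin.cons q.1 q.2 : Fin (j + 1) → ℝ) i.succ) = fun q => q.2 i := by
      funext q; simp [Fin.cons_succ]
    rw [this]
    exact (continuous_apply i).comp continuous_snd

/-! ### The peeling operators and the recursive quantities -/

/-- `peel Φ a F = (1/a) ∫₀^a Φ (a - t) (∂_{(t)} F) dt`. [cite: Polymath8b2014, §4.5, p. 18] -/
def peel (Φ : ℝ → (ℝ → ℝ) → ℝ) (a : ℝ) (F : ℝ → ℝ) : ℝ :=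
  (∫ t in (0 : ℝ)..a, Φ (a - t) (fdiff t F)) / a

/-- The truncated peeling `(1/a) ∫_ε^{max(ε,a)} Φ (a - t) (∂_{(t)} F) dt`. [cite: Polymath8b2014, §4.5, p. 18] -/
def peelT (ε : ℝ) (Φ : ℝ → (ℝ → ℝ) → ℝ) (a : ℝ) (F : ℝ → ℝ) : ℝ :=
  (∫ t in ε..max ε a, Φ (a - t) (fdiff t F)) / a

/-- `J_a(F) = (∂_{(a)}F(0))² = (F(a) - F(0))²`. [cite: Polymath8b2014, §4.5, p. 18] -/
def Jfun (a : ℝ) (F : ℝ → ℝ) : ℝ := (F a - F 0) ^ 2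

/-- `I_a(F) = ∫₀^a F'(t)² dt`. [cite: Polymath8b2014, §4.5, p. 18] -/
def Ifun (a : ℝ) (F : ℝ → ℝ) : ℝ := ∫ u in (0 : ℝ)..a, deriv F u ^ 2

/-- `Kfun r = K_{·,r+1}`: `Kfun 0 a F = J_a(F)/a`, `Kfun (r+1) = peel (Kfun r)`. [cite: Polymath8b2014, §4.5, p. 18] -/
def Kfun : ℕ → ℝ → (ℝ → ℝ) → ℝ
  | 0 => fun a F => Jfun a F / a
  | r + 1 => peel (Kfun r)

/-- `Lfun k = L_{·,k}`: `Lfun 0 = I`, `Lfun (k+1) = peel (Lfun k)`. [cite: Polymath8b2014, §4.5, p. 18] -/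
def Lfun : ℕ → ℝ → (ℝ → ℝ) → ℝ
  | 0 => Ifun
  | k + 1 => peel (Lfun k)

/-- The truncated `K`: all peeled variables and the last one are `≥ ε`.
`Mfun ε 0 a F = [a ≥ ε] J_a/a`, `Mfun ε 1 a F = (1/a) ∫_ε^{max(ε, a-ε)} J_{a-t}(∂_{(t)}F)/(a-t) dt`,
`Mfun ε (r+2) = peelT ε (Mfun ε (r+1))`. [cite: Polymath8b2014, §4.5, p. 18] -/
def Mfun (ε : ℝ) : ℕ → ℝ → (ℝ → ℝ) → ℝ
  | 0 => fun a F => if ε ≤ a then Jfun a F / a else 0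
  | 1 => fun a F => (∫ t in ε..max ε (a - ε), Kfun 0 (a - t) (fdiff t F)) / a
  | r + 2 => peelT ε (Mfun ε (r + 1))

/-- Unfolding `Kfun 0`. [folklore] -/
theorem Kfun_zero : Kfun 0 = fun a F => Jfun a F / a := rfl
/-- Unfolding `Kfun (r+1)`. [folklore] -/
theorem Kfun_succ (r : ℕ) : Kfun (r + 1) = peel (Kfun r) := rfl
/-- Unfolding `Lfun 0`. [folklore] -/
theorem Lfun_zero : Lfun 0 = Ifun := rfl
/-- Unfolding `Lfun (k+1)`. [folklore] -/
theorem Lfun_succ (k : ℕ) : Lfun (k + 1) = peel (Lfun k) := rfl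
/-- Unfolding `Mfun ε 0`. [folklore] -/
theorem Mfun_zero (ε : ℝ) : Mfun ε 0 = fun a F => if ε ≤ a then Jfun a F / a else 0 := rfl
/-- Unfolding `Mfun ε 1`. [folklore] -/
theorem Mfun_one (ε : ℝ) :
    Mfun ε 1 = fun a F => (∫ t in ε..max ε (a - ε), Kfun 0 (a - t) (fdiff t F)) / a := rfl
/-- Unfolding `Mfun ε (r+2)`. [folklore] -/
theorem Mfun_succ_succ (ε : ℝ) (r : ℕ) : Mfun ε (r + 2) = peelT ε (Mfun ε (r + 1)) := rfl

/-! ### Families: continuity and bounds -/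

/-- Continuity along all families of iterated differences of a nice function. [folklore] -/
def FamCont (Φ : ℝ → (ℝ → ℝ) → ℝ) : Prop :=
  ∀ ⦃F : ℝ → ℝ⦄ ⦃D : ℝ⦄, NiceFun F D → ∀ j : ℕ,
    Continuous (fun p : ℝ × ((Fin j → ℝ) × ℝ) => Φ p.1 (dIterV j p.2.1 (translate p.2.2 F)))

/-- The bound `|Φ a F| ≤ c D_F² |a|`. [folklore] -/
def FamBound (Φ : ℝ → (ℝ → ℝ) → ℝ) (c : ℝ) : Prop :=
  ∀ ⦃F : ℝ → ℝ⦄ ⦃D : ℝ⦄, NiceFun F D → ∀ a : ℝ, |Φ a F| ≤ c * D ^ 2 * |a|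

/-- A family bound has a nonnegative constant or the functional vanishes. [folklore] -/
theorem FamBound.nonneg_const {Φ : ℝ → (ℝ → ℝ) → ℝ} {c : ℝ} (h : FamBound Φ c) : 0 ≤ c ∨ ∀ a F D, NiceFun F D → Φ a F = 0 := by
  by_cases hc : 0 ≤ c
  · exact Or.inl hc
  · right
    intro a F D hF
    have := h hF a
    have h2 : c * D ^ 2 * |a| ≤ 0 := by
      have : c ≤ 0 := le_of_lt (not_le.1 hc)
      exact mul_nonpos_of_nonpos_of_nonneg (mul_nonpos_of_nonpos_of_nonneg this (sq_nonneg _)) (abs_nonneg _)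
    exact abs_eq_zero.1 (le_antisymm (this.trans h2) (abs_nonneg _))

/-- The integrand of a peeling along a family is continuous in `(a, s, t)`. [folklore] -/
theorem FamCont.continuous_integrand {Φ : ℝ → (ℝ → ℝ) → ℝ} (hΦ : FamCont Φ) {F : ℝ → ℝ} {D : ℝ}
    (hF : NiceFun F D) (j : ℕ) :
    Continuous (fun q : (ℝ × ((Fin j → ℝ) × ℝ)) × ℝ =>
      Φ (q.1.1 - q.2) (fdiff q.2 (dIterV j q.1.2.1 (translate q.1.2.2 F)))) := by
  have h := hΦ hF (j + 1)
  have e : ∀ q : (ℝ × ((Fin j → ℝ) × ℝ)) × ℝ, fdiff q.2 (dIterV j q.1.2.1 (translate q.1.2.2 F)) =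
      dIterV (j + 1) (Fin.cons q.2 q.1.2.1) (translate q.1.2.2 F) :=
    fun q => (dIterV_cons q.2 q.1.2.1 _).symm
  simp_rw [e]
  exact h.comp (Continuous.prodMk (continuous_fst.comp continuous_fst |>.sub continuous_snd)
    (Continuous.prodMk
      (continuous_finCons.comp (Continuous.prodMk continuous_snd (continuous_fst.comp (continuous_snd.comp continuous_fst))))
      (continuous_snd.comp (continuous_snd.comp continuous_fst))))

/-- **Bound for a peeling**: `FamBound Φ c → FamBound (peel Φ) (4c)`. [folklore] -/
theorem FamBound.peel {Φ : ℝ → (ℝ → ℝ) → ℝ} {c : ℝ} (h : FamBound Φ c) (hc : 0 ≤ c) : FamBound (peel Φ) (4 * c) := by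
  intro F D hF a
  rw [Depol.peel]
  have hb : ∀ t ∈ Ι (0 : ℝ) a, ‖Φ (a - t) (fdiff t F)‖ ≤ 4 * c * D ^ 2 * |a| := by
    intro t ht
    rw [Real.norm_eq_abs]
    have h1 := h (hF.fdiff t) (a - t)
    have hat : |a - t| ≤ |a| := by
      rcases Set.mem_uIoc.1 ht with ⟨h0, hta⟩ | ⟨ha, ht0⟩
      · rw [abs_of_nonneg (by linarith), abs_of_nonneg (by linarith)]; linarith
      · rw [abs_of_nonpos (by linarith), abs_of_nonpos (by linarith)]; linarith
    calc |Φ (a - t) (fdiff t F)| ≤ c * (D + D) ^ 2 * |a - t| := h1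
      _ ≤ c * (D + D) ^ 2 * |a| := mul_le_mul_of_nonneg_left hat (by positivity)
      _ = 4 * c * D ^ 2 * |a| := by ring
  have hint := intervalIntegral.norm_integral_le_of_norm_le_const hb
  rw [Real.norm_eq_abs, sub_zero] at hint
  by_cases ha : a = 0
  · subst ha; simp
  · rw [abs_div, div_le_iff₀ (abs_pos.2 ha)]
    exact hint

/-- **Continuity of a peeling**. [folklore] -/
theorem FamCont.peel {Φ : ℝ → (ℝ → ℝ) → ℝ} {c : ℝ} (hΦ : FamCont Φ) (hb : FamBound Φ c) (hc : 0 ≤ c) :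
    FamCont (peel Φ) := by
  intro F D hF j
  have hD := hF.nonneg
  set g : ℝ × ((Fin j → ℝ) × ℝ) → ℝ := fun p =>
    ∫ t in (0 : ℝ)..p.1, Φ (p.1 - t) (fdiff t (dIterV j p.2.1 (translate p.2.2 F))) with hg
  have hgc : Continuous g :=
    intervalIntegral.continuous_parametric_intervalIntegral_of_continuous (hΦ.continuous_integrand hF j)
      continuous_fst
  have hgb : ∀ p : ℝ × ((Fin j → ℝ) × ℝ), |g p| ≤ 4 * c * (2 ^ j * D) ^ 2 * p.1 ^ 2 := by
    intro p
    have hG := niceFun_dIterV (hF.translate p.2.2) j p.2.1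
    have hbd : ∀ t ∈ Ι (0 : ℝ) p.1, ‖Φ (p.1 - t) (fdiff t (dIterV j p.2.1 (translate p.2.2 F)))‖ ≤
        4 * c * (2 ^ j * D) ^ 2 * |p.1| := by
      intro t ht
      rw [Real.norm_eq_abs]
      have h1 := hb (hG.fdiff t) (p.1 - t)
      have hat : |p.1 - t| ≤ |p.1| := by
        rcases Set.mem_uIoc.1 ht with ⟨h0, hta⟩ | ⟨ha, ht0⟩
        · rw [abs_of_nonneg (by linarith), abs_of_nonneg (by linarith)]; linarith
        · rw [abs_of_nonpos (by linarith), abs_of_nonpos (by linarith)]; linarith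
      calc _ ≤ c * (2 ^ j * D + 2 ^ j * D) ^ 2 * |p.1 - t| := h1
        _ ≤ c * (2 ^ j * D + 2 ^ j * D) ^ 2 * |p.1| := mul_le_mul_of_nonneg_left hat (by positivity)
        _ = 4 * c * (2 ^ j * D) ^ 2 * |p.1| := by ring
    have hint := intervalIntegral.norm_integral_le_of_norm_le_const hbd
    rw [Real.norm_eq_abs, sub_zero] at hint
    calc |g p| ≤ 4 * c * (2 ^ j * D) ^ 2 * |p.1| * |p.1| := hint
      _ = 4 * c * (2 ^ j * D) ^ 2 * p.1 ^ 2 := by rw [mul_assoc, ← sq, sq_abs]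
  exact continuous_div_fst_of_bound hgc hgb

/-- **Bound for a truncated peeling**. [folklore] -/
theorem FamBound.peelT {Φ : ℝ → (ℝ → ℝ) → ℝ} {c : ℝ} (h : FamBound Φ c) (hc : 0 ≤ c) {ε : ℝ} (hε : 0 ≤ ε) :
    FamBound (peelT ε Φ) (4 * c) := by
  intro F D hF a
  rw [Depol.peelT]
  by_cases ha : a ≤ ε
  · rw [max_eq_left ha, intervalIntegral.integral_same, zero_div, abs_zero]; positivity
  · push Not at ha
    have ha0 : 0 < a := lt_of_le_of_lt hε ha
    rw [max_eq_right ha.le]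
    have hb : ∀ t ∈ Ι ε a, ‖Φ (a - t) (fdiff t F)‖ ≤ 4 * c * D ^ 2 * |a| := by
      intro t ht
      rw [Real.norm_eq_abs]
      rw [Set.uIoc_of_le ha.le, Set.mem_Ioc] at ht
      have h1 := h (hF.fdiff t) (a - t)
      have hat : |a - t| ≤ |a| := by
        rw [abs_of_nonneg (by linarith), abs_of_pos ha0]; linarith
      calc |Φ (a - t) (fdiff t F)| ≤ c * (D + D) ^ 2 * |a - t| := h1
        _ ≤ c * (D + D) ^ 2 * |a| := mul_le_mul_of_nonneg_left hat (by positivity)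
        _ = 4 * c * D ^ 2 * |a| := by ring
    have hint := intervalIntegral.norm_integral_le_of_norm_le_const hb
    rw [Real.norm_eq_abs] at hint
    rw [abs_div, div_le_iff₀ (abs_pos.2 ha0.ne')]
    calc _ ≤ 4 * c * D ^ 2 * |a| * |a - ε| := hint
      _ ≤ 4 * c * D ^ 2 * |a| * |a| := by
          refine mul_le_mul_of_nonneg_left ?_ (by positivity)
          rw [abs_of_nonneg (by linarith), abs_of_pos ha0]; linarith

/-- **Continuity of a truncated peeling** (of an everywhere-continuous family). [folklore] -/
theorem FamCont.peelT {Φ : ℝ → (ℝ → ℝ) → ℝ} {c : ℝ} (hΦ : FamCont Φ) (hb : FamBound Φ c) (hc : 0 ≤ c)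
    {ε : ℝ} (hε : 0 < ε) : FamCont (peelT ε Φ) := by
  intro F D hF j
  have hD := hF.nonneg
  set g : ℝ × ((Fin j → ℝ) × ℝ) → ℝ := fun p =>
    ∫ t in ε..max ε p.1, Φ (p.1 - t) (fdiff t (dIterV j p.2.1 (translate p.2.2 F))) with hg
  have hgc : Continuous g :=
    intervalIntegral.continuous_parametric_intervalIntegral_of_continuous (hΦ.continuous_integrand hF j)
      (continuous_const.max continuous_fst)
  have hgb : ∀ p : ℝ × ((Fin j → ℝ) × ℝ), |g p| ≤ 4 * c * (2 ^ j * D) ^ 2 * p.1 ^ 2 := by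
    intro p
    have hG := niceFun_dIterV (hF.translate p.2.2) j p.2.1
    by_cases ha : p.1 ≤ ε
    · have : g p = 0 := by
        simp only [hg, max_eq_left ha, intervalIntegral.integral_same]
      rw [this, abs_zero]; positivity
    · push Not at ha
      have ha0 : 0 < p.1 := lt_trans hε ha
      have hbd : ∀ t ∈ Ι ε p.1, ‖Φ (p.1 - t) (fdiff t (dIterV j p.2.1 (translate p.2.2 F)))‖ ≤
          4 * c * (2 ^ j * D) ^ 2 * |p.1| := by
        intro t ht
        rw [Set.uIoc_of_le ha.le, Set.mem_Ioc] at ht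
        rw [Real.norm_eq_abs]
        have h1 := hb (hG.fdiff t) (p.1 - t)
        have hat : |p.1 - t| ≤ |p.1| := by
          rw [abs_of_nonneg (by linarith), abs_of_pos ha0]; linarith
        calc _ ≤ c * (2 ^ j * D + 2 ^ j * D) ^ 2 * |p.1 - t| := h1
          _ ≤ c * (2 ^ j * D + 2 ^ j * D) ^ 2 * |p.1| := mul_le_mul_of_nonneg_left hat (by positivity)
          _ = 4 * c * (2 ^ j * D) ^ 2 * |p.1| := by ring
      have hint := intervalIntegral.norm_integral_le_of_norm_le_const hbd
      rw [Real.norm_eq_abs] at hint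
      calc |g p| = |∫ t in ε..p.1, Φ (p.1 - t) (fdiff t (dIterV j p.2.1 (translate p.2.2 F)))| := by
            simp only [hg, max_eq_right ha.le]
        _ ≤ 4 * c * (2 ^ j * D) ^ 2 * |p.1| * |p.1 - ε| := hint
        _ ≤ 4 * c * (2 ^ j * D) ^ 2 * |p.1| * |p.1| := by
            refine mul_le_mul_of_nonneg_left ?_ (by positivity)
            rw [abs_of_nonneg (by linarith), abs_of_pos ha0]; linarith
        _ = 4 * c * (2 ^ j * D) ^ 2 * p.1 ^ 2 := by
            rw [mul_assoc, ← sq, sq_abs]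
  exact continuous_div_fst_of_bound hgc hgb

/-! ### The base cases -/

/-- Bound for `Kfun 0`. [folklore] -/
theorem famBound_Kfun_zero : FamBound (Kfun 0) 1 := by
  intro F D hF a
  rw [Kfun_zero]
  simp only [Jfun]
  by_cases ha : a = 0
  · subst ha; simp
  · rw [abs_div, div_le_iff₀ (abs_pos.2 ha), abs_of_nonneg (sq_nonneg _)]
    have h := hF.abs_sub_le a 0
    rw [sub_zero] at h
    calc (F a - F 0) ^ 2 = |F a - F 0| ^ 2 := (sq_abs _).symm
      _ ≤ (D * |a|) ^ 2 := pow_le_pow_left₀ (abs_nonneg _) h 2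
      _ = 1 * D ^ 2 * |a| * |a| := by ring

/-- Continuity of `Kfun 0`. [folklore] -/
theorem famCont_Kfun_zero : FamCont (Kfun 0) := by
  intro F D hF j
  rw [Kfun_zero]
  simp only [Jfun]
  have hc := continuous_dIterV_translate hF.continuous j
  have hnum : Continuous (fun p : ℝ × ((Fin j → ℝ) × ℝ) =>
      (dIterV j p.2.1 (translate p.2.2 F) p.1 - dIterV j p.2.1 (translate p.2.2 F) 0) ^ 2) :=
    ((hc.comp (Continuous.prodMk continuous_snd continuous_fst)).sub
      (hc.comp (Continuous.prodMk continuous_snd continuous_const))).pow 2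
  refine continuous_div_fst_of_bound hnum (C := (2 ^ j * D) ^ 2) fun p => ?_
  have hG := niceFun_dIterV (hF.translate p.2.2) j p.2.1
  have h := hG.abs_sub_le p.1 0
  rw [sub_zero] at h
  rw [abs_of_nonneg (sq_nonneg _)]
  calc (dIterV j p.2.1 (translate p.2.2 F) p.1 - dIterV j p.2.1 (translate p.2.2 F) 0) ^ 2
      = |dIterV j p.2.1 (translate p.2.2 F) p.1 - dIterV j p.2.1 (translate p.2.2 F) 0| ^ 2 := (sq_abs _).symm
    _ ≤ (2 ^ j * D * |p.1|) ^ 2 := pow_le_pow_left₀ (abs_nonneg _) h 2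
    _ = (2 ^ j * D) ^ 2 * p.1 ^ 2 := by rw [mul_pow, sq_abs]

/-- Bound for `Lfun 0`. [folklore] -/
theorem famBound_Lfun_zero : FamBound (Lfun 0) 1 := by
  intro F D hF a
  rw [Lfun_zero]
  simp only [Ifun]
  have hb : ∀ u ∈ Ι (0 : ℝ) a, ‖deriv F u ^ 2‖ ≤ D ^ 2 := by
    intro u _
    rw [Real.norm_eq_abs, abs_of_nonneg (sq_nonneg _), ← sq_abs]
    exact pow_le_pow_left₀ (abs_nonneg _) (hF.bound1 u) 2
  have hint := intervalIntegral.norm_integral_le_of_norm_le_const hb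
  rw [Real.norm_eq_abs, sub_zero] at hint
  linarith

/-- Continuity of `Lfun 0`. [folklore] -/
theorem famCont_Lfun_zero : FamCont (Lfun 0) := by
  intro F D hF j
  rw [Lfun_zero]
  simp only [Ifun]
  have hderiv : ∀ (s : Fin j → ℝ) (u : ℝ), deriv (dIterV j s (translate u F)) = dIterV j s (translate u (deriv F)) := by
    intro s u
    rw [deriv_dIterV (hF.translate u) j, deriv_translate F u]
  simp_rw [hderiv]
  have hc := continuous_dIterV_translate hF.continuous_deriv j
  have hint : Continuous (fun q : (ℝ × ((Fin j → ℝ) × ℝ)) × ℝ => dIterV j q.1.2.1 (translate q.1.2.2 (deriv F)) q.2 ^ 2) :=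
    (hc.comp (Continuous.prodMk (continuous_snd.comp continuous_fst) continuous_snd)).pow 2
  exact intervalIntegral.continuous_parametric_intervalIntegral_of_continuous hint continuous_fst

/-! ### All orders -/

/-- Bounds and continuity of `Kfun r`: `|K| ≤ 4^r D² |a|`. [folklore] -/
theorem famBound_Kfun : ∀ r : ℕ, FamBound (Kfun r) (4 ^ r)
  | 0 => by simpa using famBound_Kfun_zero
  | r + 1 => by
    rw [Kfun_succ, pow_succ, mul_comm]
    exact (famBound_Kfun r).peel (by positivity)

/-- Continuity of all `Kfun r`. [folklore] -/
theorem famCont_Kfun : ∀ r : ℕ, FamCont (Kfun r)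
  | 0 => famCont_Kfun_zero
  | r + 1 => by
    rw [Kfun_succ]
    exact (famCont_Kfun r).peel (famBound_Kfun r) (by positivity)

/-- Bounds for all `Lfun k`. [folklore] -/
theorem famBound_Lfun : ∀ k : ℕ, FamBound (Lfun k) (4 ^ k)
  | 0 => by simpa using famBound_Lfun_zero
  | k + 1 => by
    rw [Lfun_succ, pow_succ, mul_comm]
    exact (famBound_Lfun k).peel (by positivity)

/-- Continuity of all `Lfun k`. [folklore] -/
theorem famCont_Lfun : ∀ k : ℕ, FamCont (Lfun k)
  | 0 => famCont_Lfun_zero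
  | k + 1 => by
    rw [Lfun_succ]
    exact (famCont_Lfun k).peel (famBound_Lfun k) (by positivity)

/-- `Mfun ε 1` as a truncated peeling of `Kfun 0` with upper limit `max ε (a - ε)`: bound. [folklore] -/
theorem famBound_Mfun_one {ε : ℝ} (hε : 0 ≤ ε) : FamBound (Mfun ε 1) 4 := by
  intro F D hF a
  rw [Mfun_one]
  simp only
  by_cases ha : a - ε ≤ ε
  · rw [max_eq_left ha, intervalIntegral.integral_same, zero_div, abs_zero]; positivity
  · push Not at ha
    have ha0 : 0 < a := by linarith
    rw [max_eq_right ha.le]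
    have hb : ∀ t ∈ Ι ε (a - ε), ‖Kfun 0 (a - t) (fdiff t F)‖ ≤ 4 * D ^ 2 * |a| := by
      intro t ht
      rw [Set.uIoc_of_le ha.le, Set.mem_Ioc] at ht
      rw [Real.norm_eq_abs]
      have h1 := famBound_Kfun_zero (hF.fdiff t) (a - t)
      have hat : |a - t| ≤ |a| := by rw [abs_of_nonneg (by linarith), abs_of_pos ha0]; linarith
      calc _ ≤ 1 * (D + D) ^ 2 * |a - t| := h1
        _ ≤ 1 * (D + D) ^ 2 * |a| := mul_le_mul_of_nonneg_left hat (by positivity)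
        _ = 4 * D ^ 2 * |a| := by ring
    have hint := intervalIntegral.norm_integral_le_of_norm_le_const hb
    rw [Real.norm_eq_abs] at hint
    rw [abs_div, div_le_iff₀ (abs_pos.2 ha0.ne')]
    calc _ ≤ 4 * D ^ 2 * |a| * |a - ε - ε| := hint
      _ ≤ 4 * D ^ 2 * |a| * |a| := by
          refine mul_le_mul_of_nonneg_left ?_ (by positivity)
          rw [abs_of_nonneg (by linarith), abs_of_pos ha0]; linarith

/-- Continuity of `Mfun ε 1`. [folklore] -/
theorem famCont_Mfun_one {ε : ℝ} (hε : 0 < ε) : FamCont (Mfun ε 1) := by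
  intro F D hF j
  rw [Mfun_one]
  simp only
  have hD := hF.nonneg
  set g : ℝ × ((Fin j → ℝ) × ℝ) → ℝ := fun p =>
    ∫ t in ε..max ε (p.1 - ε), Kfun 0 (p.1 - t) (fdiff t (dIterV j p.2.1 (translate p.2.2 F))) with hg
  have hgc : Continuous g :=
    intervalIntegral.continuous_parametric_intervalIntegral_of_continuous (famCont_Kfun_zero.continuous_integrand hF j)
      (continuous_const.max (continuous_fst.sub continuous_const))
  have hgb : ∀ p : ℝ × ((Fin j → ℝ) × ℝ), |g p| ≤ 4 * (2 ^ j * D) ^ 2 * p.1 ^ 2 := by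
    intro p
    have hG := niceFun_dIterV (hF.translate p.2.2) j p.2.1
    by_cases ha : p.1 - ε ≤ ε
    · have : g p = 0 := by simp only [hg, max_eq_left ha, intervalIntegral.integral_same]
      rw [this, abs_zero]; positivity
    · push Not at ha
      have ha0 : 0 < p.1 := by linarith
      have hbd : ∀ t ∈ Ι ε (max ε (p.1 - ε)), ‖Kfun 0 (p.1 - t) (fdiff t (dIterV j p.2.1 (translate p.2.2 F)))‖ ≤
          4 * (2 ^ j * D) ^ 2 * |p.1| := by
        intro t ht
        rw [max_eq_right ha.le, Set.uIoc_of_le ha.le, Set.mem_Ioc] at ht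
        rw [Real.norm_eq_abs]
        have h1 := famBound_Kfun_zero (hG.fdiff t) (p.1 - t)
        have hat : |p.1 - t| ≤ |p.1| := by rw [abs_of_nonneg (by linarith), abs_of_pos ha0]; linarith
        calc _ ≤ 1 * (2 ^ j * D + 2 ^ j * D) ^ 2 * |p.1 - t| := h1
          _ ≤ 1 * (2 ^ j * D + 2 ^ j * D) ^ 2 * |p.1| := mul_le_mul_of_nonneg_left hat (by positivity)
          _ = 4 * (2 ^ j * D) ^ 2 * |p.1| := by ring
      have hint := intervalIntegral.norm_integral_le_of_norm_le_const hbd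
      rw [Real.norm_eq_abs, max_eq_right ha.le] at hint
      calc |g p| = |∫ t in ε..p.1 - ε, Kfun 0 (p.1 - t) (fdiff t (dIterV j p.2.1 (translate p.2.2 F)))| := by
            simp only [hg, max_eq_right ha.le]
        _ ≤ 4 * (2 ^ j * D) ^ 2 * |p.1| * |p.1 - ε - ε| := hint
        _ ≤ 4 * (2 ^ j * D) ^ 2 * |p.1| * |p.1| := by
            refine mul_le_mul_of_nonneg_left ?_ (by positivity)
            rw [abs_of_nonneg (by linarith), abs_of_pos ha0]; linarith
        _ = 4 * (2 ^ j * D) ^ 2 * p.1 ^ 2 := by rw [mul_assoc, ← sq, sq_abs]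
  exact continuous_div_fst_of_bound hgc hgb

/-- Bounds for `Mfun ε (r+1)`: `|M| ≤ 4^{r+1} D² |a|`. [folklore] -/
theorem famBound_Mfun_succ {ε : ℝ} (hε : 0 ≤ ε) : ∀ r : ℕ, FamBound (Mfun ε (r + 1)) (4 ^ (r + 1))
  | 0 => by simpa using famBound_Mfun_one hε
  | r + 1 => by
    rw [Mfun_succ_succ, pow_succ, mul_comm]
    exact (famBound_Mfun_succ hε r).peelT (by positivity) hε

/-- Continuity of all `Mfun ε (r+1)`. [folklore] -/
theorem famCont_Mfun_succ {ε : ℝ} (hε : 0 < ε) : ∀ r : ℕ, FamCont (Mfun ε (r + 1))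
  | 0 => famCont_Mfun_one hε
  | r + 1 => by
    rw [Mfun_succ_succ]
    exact (famCont_Mfun_succ hε r).peelT (famBound_Mfun_succ hε.le r) (by positivity) hε

/-- The base `Mfun ε 0` is bounded like `Kfun 0`. [folklore] -/
theorem famBound_Mfun_zero (ε : ℝ) : FamBound (Mfun ε 0) 1 := by
  intro F D hF a
  rw [Mfun_zero]
  simp only
  split_ifs
  · exact famBound_Kfun_zero hF a
  · rw [abs_zero]; have := hF.nonneg; positivity

/-! ### Consequences: continuity in `a`, measurability and integrability of the integrands -/

/-- A family-continuous functional is continuous in `a` at a fixed nice `F`. [folklore] -/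
theorem translate_zero (F : ℝ → ℝ) : translate 0 F = F := by funext v; simp [translate]

/-- Continuity in `a` at a fixed nice function. [folklore] -/
theorem FamCont.continuous_in_a {Φ : ℝ → (ℝ → ℝ) → ℝ} (hΦ : FamCont Φ) {F : ℝ → ℝ} {D : ℝ} (hF : NiceFun F D) :
    Continuous (fun a => Φ a F) := by
  have h := hΦ hF 0
  have := h.comp (Continuous.prodMk continuous_id (continuous_const (y := ((Fin.elim0 : Fin 0 → ℝ), (0 : ℝ)))))
  simpa [Function.comp_def, translate_zero] using this

/-- Joint continuity in `(a, u)` of `Φ a (τ_u F)`. [folklore] -/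
theorem FamCont.continuous_translate {Φ : ℝ → (ℝ → ℝ) → ℝ} (hΦ : FamCont Φ) {F : ℝ → ℝ} {D : ℝ} (hF : NiceFun F D) :
    Continuous (fun p : ℝ × ℝ => Φ p.1 (translate p.2 F)) := by
  have h := hΦ hF 0
  exact h.comp (Continuous.prodMk continuous_fst
    (Continuous.prodMk (continuous_const (y := (Fin.elim0 : Fin 0 → ℝ))) continuous_snd))

/-- The peeling integrand `(a, u, t) ↦ Φ (a - t) (∂_{(t)} τ_u F)` is continuous. [folklore] -/
theorem FamCont.continuous_peelIntegrand₃ {Φ : ℝ → (ℝ → ℝ) → ℝ} (hΦ : FamCont Φ) {F : ℝ → ℝ} {D : ℝ}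
    (hF : NiceFun F D) : Continuous (fun q : (ℝ × ℝ) × ℝ => Φ (q.1.1 - q.2) (fdiff q.2 (translate q.1.2 F))) := by
  have h := hΦ.continuous_integrand hF 0
  exact h.comp (Continuous.prodMk (Continuous.prodMk (continuous_fst.comp continuous_fst)
    (Continuous.prodMk (continuous_const (y := (Fin.elim0 : Fin 0 → ℝ))) (continuous_snd.comp continuous_fst)))
    continuous_snd)

/-- The peeling integrand `t ↦ Φ (a - t) (∂_{(t)} F)` is continuous. [folklore] -/
theorem FamCont.continuous_peelIntegrand {Φ : ℝ → (ℝ → ℝ) → ℝ} (hΦ : FamCont Φ) {F : ℝ → ℝ} {D : ℝ}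
    (hF : NiceFun F D) (a : ℝ) : Continuous (fun t => Φ (a - t) (fdiff t F)) := by
  have h := hΦ.continuous_peelIntegrand₃ hF
  have := h.comp (Continuous.prodMk (continuous_const (y := ((a, (0 : ℝ)) : ℝ × ℝ))) continuous_id)
  simpa [Function.comp_def, translate_zero] using this

/-- The peeling integrand is interval integrable. [folklore] -/
theorem FamCont.intervalIntegrable {Φ : ℝ → (ℝ → ℝ) → ℝ} (hΦ : FamCont Φ) {F : ℝ → ℝ} {D : ℝ}
    (hF : NiceFun F D) (a b₁ b₂ : ℝ) : IntervalIntegrable (fun t => Φ (a - t) (fdiff t F)) volume b₁ b₂ :=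
  (hΦ.continuous_peelIntegrand hF a).intervalIntegrable _ _

/-! ### Fubini on the triangle `{u, t ≥ 0, u + t ≤ a}` -/

/-- **Swapping the order of integration on a triangle**: for continuous `g` and `a ≥ 0`,
`∫₀^a ∫₀^{a-t} g(u,t) du dt = ∫₀^a ∫₀^{a-u} g(u,t) dt du`. [folklore] -/
theorem triangle_swap {g : ℝ × ℝ → ℝ} (hg : Continuous g) {a : ℝ} (ha : 0 ≤ a) :
    ∫ t in (0 : ℝ)..a, ∫ u in (0 : ℝ)..(a - t), g (u, t) =
      ∫ u in (0 : ℝ)..a, ∫ t in (0 : ℝ)..(a - u), g (u, t) := by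
  set s : Set ℝ := Set.Ioc 0 a with hs
  set T : Set (ℝ × ℝ) := {p | p.1 + p.2 ≤ a} with hT
  have hTm : MeasurableSet T := measurableSet_le (measurable_fst.add measurable_snd) measurable_const
  set H : ℝ × ℝ → ℝ := T.indicator g with hH
  have hHm : Measurable H := hg.measurable.indicator hTm
  -- a bound for `g` on the square
  obtain ⟨B, hB⟩ : ∃ B, ∀ p ∈ Set.Icc (0 : ℝ) a ×ˢ Set.Icc (0 : ℝ) a, |g p| ≤ B := by
    have hK : IsCompact (Set.Icc (0 : ℝ) a ×ˢ Set.Icc (0 : ℝ) a) := isCompact_Icc.prod isCompact_Icc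
    obtain ⟨B, hB⟩ := hK.exists_bound_of_continuousOn hg.continuousOn
    exact ⟨B, fun p hp => by have := hB p hp; rwa [Real.norm_eq_abs] at this⟩
  have hHB : ∀ p ∈ s ×ˢ s, |H p| ≤ |B| := by
    intro p hp
    rw [hH, Set.indicator_apply]
    split_ifs
    · refine (hB p ⟨Set.Ioc_subset_Icc_self hp.1, Set.Ioc_subset_Icc_self hp.2⟩).trans (le_abs_self B)
    · rw [abs_zero]; exact abs_nonneg B
  -- inner integrals as set integrals of `H`
  have hinner1 : ∀ t ∈ s, ∫ u in (0 : ℝ)..(a - t), g (u, t) = ∫ u in s, H (u, t) := by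
    intro t ht
    rw [hs, Set.mem_Ioc] at ht
    rw [intervalIntegral.integral_of_le (by linarith)]
    have hset : Set.Ioc 0 (a - t) = s ∩ {u | (u, t) ∈ T} := by
      ext u; simp only [hs, hT, Set.mem_Ioc, Set.mem_inter_iff, Set.mem_setOf_eq]; constructor
      · rintro ⟨h1, h2⟩; exact ⟨⟨h1, by linarith⟩, by linarith⟩
      · rintro ⟨⟨h1, -⟩, h2⟩; exact ⟨h1, by linarith⟩
    have hmeas : MeasurableSet {u : ℝ | (u, t) ∈ T} :=
      hTm.preimage (measurable_id.prodMk measurable_const)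
    rw [hset, ← setIntegral_indicator hmeas]
    refine setIntegral_congr_fun measurableSet_Ioc fun u _ => ?_
    simp only [hH, Set.indicator_apply, Set.mem_setOf_eq]
  have hinner2 : ∀ u ∈ s, ∫ t in (0 : ℝ)..(a - u), g (u, t) = ∫ t in s, H (u, t) := by
    intro u hu
    rw [hs, Set.mem_Ioc] at hu
    rw [intervalIntegral.integral_of_le (by linarith)]
    have hset : Set.Ioc 0 (a - u) = s ∩ {t | (u, t) ∈ T} := by
      ext t; simp only [hs, hT, Set.mem_Ioc, Set.mem_inter_iff, Set.mem_setOf_eq]; constructor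
      · rintro ⟨h1, h2⟩; exact ⟨⟨h1, by linarith⟩, by linarith⟩
      · rintro ⟨⟨h1, -⟩, h2⟩; exact ⟨h1, by linarith⟩
    have hmeas : MeasurableSet {t : ℝ | (u, t) ∈ T} :=
      hTm.preimage (measurable_const.prodMk measurable_id)
    rw [hset, ← setIntegral_indicator hmeas]
    refine setIntegral_congr_fun measurableSet_Ioc fun t _ => ?_
    simp only [hH, Set.indicator_apply, Set.mem_setOf_eq]
  rw [intervalIntegral.integral_of_le ha, intervalIntegral.integral_of_le ha,
    setIntegral_congr_fun measurableSet_Ioc hinner1, setIntegral_congr_fun measurableSet_Ioc hinner2]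
  -- Fubini
  have hvol : (volume : Measure ℝ) s < ⊤ := by rw [hs, Real.volume_Ioc]; exact ENNReal.ofReal_lt_top
  have hint : IntegrableOn H (s ×ˢ s) (volume.prod volume) := by
    refine IntegrableOn.of_bound ?_ hHm.aestronglyMeasurable |B| ?_
    · rw [Measure.prod_prod]; exact ENNReal.mul_lt_top hvol hvol
    · rw [ae_restrict_iff' (measurableSet_Ioc.prod measurableSet_Ioc)]
      exact Eventually.of_forall fun p hp => by rw [Real.norm_eq_abs]; exact hHB p hp
  have hint' : IntegrableOn (fun z : ℝ × ℝ => H z.swap) (s ×ˢ s) (volume.prod volume) := by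
    refine IntegrableOn.of_bound ?_ (hHm.comp measurable_swap).aestronglyMeasurable |B| ?_
    · rw [Measure.prod_prod]; exact ENNReal.mul_lt_top hvol hvol
    · rw [ae_restrict_iff' (measurableSet_Ioc.prod measurableSet_Ioc)]
      exact Eventually.of_forall fun p hp => by
        rw [Real.norm_eq_abs]; exact hHB p.swap ⟨hp.2, hp.1⟩
  have h1 : ∫ z in s ×ˢ s, H z ∂(volume.prod volume) = ∫ u in s, ∫ t in s, H (u, t) :=
    setIntegral_prod H hint
  have h2 : ∫ z in s ×ˢ s, (fun w : ℝ × ℝ => H w.swap) z ∂(volume.prod volume) =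
      ∫ t in s, ∫ u in s, H (u, t) := by
    rw [setIntegral_prod _ hint']
    rfl
  have h3 : ∫ z in s ×ˢ s, (fun w : ℝ × ℝ => H w.swap) z ∂(volume.prod volume) =
      ∫ z in s ×ˢ s, H z ∂(volume.prod volume) := by
    have := setIntegral_prod_swap (μ := (volume : Measure ℝ)) (ν := (volume : Measure ℝ)) s s H
    simpa using this
  rw [← h2, h3, h1]

/-! ### The renewal identity `I_a = J_a/a + (1/a)∫₀^a I_{a-t}(∂_{(t)}F) dt` -/

section Renewal

variable {F : ℝ → ℝ} {D : ℝ}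

/-- `∫₀^a ∫₀^t h = ∫₀^a (a - s) h(s) ds` for continuous `h`. [folklore] -/
theorem integral_integral_Iic_eq {h : ℝ → ℝ} (hh : Continuous h) {a : ℝ} (ha : 0 ≤ a) :
    ∫ t in (0 : ℝ)..a, ∫ u in (0 : ℝ)..t, h u = ∫ u in (0 : ℝ)..a, (a - u) * h u := by
  -- reflect `t ↦ a - t` and swap on the triangle
  have h1 : ∫ t in (0 : ℝ)..a, ∫ u in (0 : ℝ)..t, h u = ∫ t in (0 : ℝ)..a, ∫ u in (0 : ℝ)..(a - t), h u := by
    have := intervalIntegral.integral_comp_sub_left (fun t => ∫ u in (0 : ℝ)..t, h u) a (a := 0) (b := a)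
    simp only [sub_self, sub_zero] at this
    rw [this]
  rw [h1]
  have h2 := triangle_swap (g := fun p : ℝ × ℝ => h p.1) (hh.comp continuous_fst) ha
  simp only at h2
  rw [h2]
  refine intervalIntegral.integral_congr fun u _ => ?_
  simp only [intervalIntegral.integral_const, smul_eq_mul, sub_zero]

/-- **The renewal identity** (p. 18): for `a ≥ 0` and nice `F`,
`∫₀^a ∫₀^{a-t} (F'(u+t) - F'(u))² du dt = a I_a(F) - J_a(F)`. [cite: Polymath8b2014, §4.5, p. 18] -/
theorem renewal_integral (hF : NiceFun F D) {a : ℝ} (ha : 0 ≤ a) :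
    ∫ t in (0 : ℝ)..a, Ifun (a - t) (fdiff t F) = a * Ifun a F - Jfun a F := by
  set f := deriv F with hf
  have hfc : Continuous f := hF.continuous_deriv
  have hf2 : Continuous (fun s => f s ^ 2) := hfc.pow 2
  -- the integrand
  have hI : ∀ t, Ifun (a - t) (fdiff t F) = ∫ u in (0 : ℝ)..(a - t), (f (u + t) - f u) ^ 2 := by
    intro t
    simp only [Ifun, hF.deriv_fdiff t, fdiff_apply]
    rfl
  simp_rw [hI]
  -- expand the square
  have hexp : ∀ t, ∫ u in (0 : ℝ)..(a - t), (f (u + t) - f u) ^ 2 =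
      (∫ u in (0 : ℝ)..(a - t), f (u + t) ^ 2) + (∫ u in (0 : ℝ)..(a - t), f u ^ 2) -
        2 * ∫ u in (0 : ℝ)..(a - t), f (u + t) * f u := by
    intro t
    have i1 : IntervalIntegrable (fun u => f (u + t) ^ 2) volume 0 (a - t) :=
      ((hfc.comp (continuous_id.add continuous_const)).pow 2).intervalIntegrable _ _
    have i2 : IntervalIntegrable (fun u => f u ^ 2) volume 0 (a - t) := (hfc.pow 2).intervalIntegrable _ _
    have i3 : IntervalIntegrable (fun u => f (u + t) * f u) volume 0 (a - t) :=
      ((hfc.comp (continuous_id.add continuous_const)).mul hfc).intervalIntegrable _ _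
    have e : ∀ u, (f (u + t) - f u) ^ 2 = (f (u + t) ^ 2 + f u ^ 2) - 2 * (f (u + t) * f u) := fun u => by ring
    simp_rw [e]
    rw [intervalIntegral.integral_sub (i1.add i2) (i3.const_mul 2), intervalIntegral.integral_add i1 i2,
      intervalIntegral.integral_const_mul]
  simp_rw [hexp]
  -- integrate term by term over `t`
  have c1 : Continuous fun t => ∫ u in (0 : ℝ)..(a - t), f (u + t) ^ 2 := by
    have : Continuous (Function.uncurry fun (t u : ℝ) => f (u + t) ^ 2) :=
      (hfc.comp (continuous_snd.add continuous_fst)).pow 2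
    exact intervalIntegral.continuous_parametric_intervalIntegral_of_continuous this (continuous_const.sub continuous_id)
  have c2 : Continuous fun t => ∫ u in (0 : ℝ)..(a - t), f u ^ 2 := by
    have : Continuous (Function.uncurry fun (t u : ℝ) => f u ^ 2) := (hfc.comp continuous_snd).pow 2
    exact intervalIntegral.continuous_parametric_intervalIntegral_of_continuous this (continuous_const.sub continuous_id)
  have c3 : Continuous fun t => ∫ u in (0 : ℝ)..(a - t), f (u + t) * f u := by
    have : Continuous (Function.uncurry fun (t u : ℝ) => f (u + t) * f u) :=
      (hfc.comp (continuous_snd.add continuous_fst)).mul (hfc.comp continuous_snd)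
    exact intervalIntegral.continuous_parametric_intervalIntegral_of_continuous this (continuous_const.sub continuous_id)
  rw [intervalIntegral.integral_sub ((c1.intervalIntegrable _ _).add (c2.intervalIntegrable _ _))
      ((c3.intervalIntegrable _ _).const_mul 2),
    intervalIntegral.integral_add (c1.intervalIntegrable _ _) (c2.intervalIntegrable _ _),
    intervalIntegral.integral_const_mul]
  -- (S₁) `∫₀^a ∫₀^{a-t} f(u+t)² du dt = a I_a - ∫₀^a (a - s) f(s)² ds`
  have hS1 : ∫ t in (0 : ℝ)..a, ∫ u in (0 : ℝ)..(a - t), f (u + t) ^ 2 =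
      a * Ifun a F - ∫ s in (0 : ℝ)..a, (a - s) * f s ^ 2 := by
    have e1 : ∀ t, ∫ u in (0 : ℝ)..(a - t), f (u + t) ^ 2 = (∫ s in (0 : ℝ)..a, f s ^ 2) - ∫ s in (0 : ℝ)..t, f s ^ 2 := by
      intro t
      rw [intervalIntegral.integral_comp_add_right (fun s => f s ^ 2) t, zero_add, sub_add_cancel]
      exact (intervalIntegral.integral_interval_sub_left (hf2.intervalIntegrable _ _) (hf2.intervalIntegrable _ _)).symm
    simp_rw [e1]
    have iP : IntervalIntegrable (fun t => ∫ s in (0 : ℝ)..t, f s ^ 2) volume 0 a :=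
      (intervalIntegral.continuous_primitive (fun _ _ => hf2.intervalIntegrable _ _) 0).intervalIntegrable _ _
    have iC : IntervalIntegrable (fun _ : ℝ => ∫ s in (0 : ℝ)..a, f s ^ 2) volume 0 a := intervalIntegrable_const
    rw [intervalIntegral.integral_sub iC iP, intervalIntegral.integral_const, smul_eq_mul, sub_zero,
      integral_integral_Iic_eq hf2 ha]
    rfl
  -- (S₂) `∫₀^a ∫₀^{a-t} f(u)² du dt = ∫₀^a (a - u) f(u)² du`
  have hS2 : ∫ t in (0 : ℝ)..a, ∫ u in (0 : ℝ)..(a - t), f u ^ 2 = ∫ u in (0 : ℝ)..a, (a - u) * f u ^ 2 := by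
    have h2 := triangle_swap (g := fun p : ℝ × ℝ => f p.1 ^ 2) ((hfc.comp continuous_fst).pow 2) ha
    simp only at h2
    rw [h2]
    refine intervalIntegral.integral_congr fun u _ => ?_
    simp only [intervalIntegral.integral_const, smul_eq_mul, sub_zero]
  -- (C) `∫₀^a ∫₀^{a-t} f(u+t) f(u) du dt = (F(a) - F(0))²/2`
  have hC : ∫ t in (0 : ℝ)..a, ∫ u in (0 : ℝ)..(a - t), f (u + t) * f u = (F a - F 0) ^ 2 / 2 := by
    have h2 := triangle_swap (g := fun p : ℝ × ℝ => f (p.1 + p.2) * f p.1)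
      ((hfc.comp (continuous_fst.add continuous_snd)).mul (hfc.comp continuous_fst)) ha
    rw [h2]
    -- inner: `∫₀^{a-u} f(u+t) dt = F(a) - F(u)`
    have hinner : ∀ u, ∫ t in (0 : ℝ)..(a - u), f (u + t) * f u = (F a - F u) * f u := by
      intro u
      rw [intervalIntegral.integral_mul_const]
      congr 1
      rw [intervalIntegral.integral_comp_add_left (fun s => f s) u, add_zero, add_sub_cancel]
      exact intervalIntegral.integral_deriv_eq_sub (fun x _ => hF.differentiable.differentiableAt)
        (hfc.intervalIntegrable _ _)
    simp_rw [hinner]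
    -- `∫₀^a (F a - F u) f u du = F a (F a - F 0) - (F a² - F 0²)/2`
    have hFF : ∫ u in (0 : ℝ)..a, F u * f u = (F a ^ 2 - F 0 ^ 2) / 2 := by
      have hd : ∀ x ∈ Set.uIcc (0 : ℝ) a, HasDerivAt (fun u => F u ^ 2 / 2) (F x * f x) x := by
        intro x _
        have h1 : HasDerivAt F (f x) x := hF.differentiable.differentiableAt.hasDerivAt
        have h3 := (h1.mul h1).div_const 2
        have e1 : (fun u => F u ^ 2 / 2) = fun y => (F * F) y / 2 := by funext u; simp [sq]
        rw [e1]
        exact h3.congr_deriv (by ring)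
      have := intervalIntegral.integral_eq_sub_of_hasDerivAt hd ((hF.continuous.mul hfc).intervalIntegrable _ _)
      rw [this]; ring
    have e : ∀ u, (F a - F u) * f u = F a * f u - F u * f u := fun u => by ring
    simp_rw [e]
    have i1 : IntervalIntegrable (fun u => F a * f u) volume 0 a := (hfc.const_mul (F a)).intervalIntegrable 0 a
    have i2 : IntervalIntegrable (fun u => F u * f u) volume 0 a := (hF.continuous.mul hfc).intervalIntegrable 0 a
    rw [intervalIntegral.integral_sub i1 i2, intervalIntegral.integral_const_mul, hFF,
      intervalIntegral.integral_deriv_eq_sub (fun x _ => hF.differentiable.differentiableAt) (hfc.intervalIntegrable _ _)]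
    ring
  rw [hS1, hS2, hC, Jfun]
  ring

/-- **The renewal identity** `I_a(F) = J_a(F)/a + (1/a) ∫₀^a I_{a-t}(∂_{(t)} F) dt`, i.e.
`Lfun 0 a F = Kfun 0 a F + Lfun 1 a F`, for `a ≥ 0`. [cite: Polymath8b2014, §4.5, p. 18] -/
theorem Lfun_zero_eq (hF : NiceFun F D) {a : ℝ} (ha : 0 ≤ a) : Lfun 0 a F = Kfun 0 a F + Lfun 1 a F := by
  rw [Lfun_succ, Lfun_zero, Kfun_zero, peel]
  simp only
  rw [renewal_integral hF ha]
  rcases eq_or_lt_of_le ha with rfl | ha0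
  · simp [Ifun]
  · field_simp
    ring

end Renewal

/-! ### `I_a = Σ_{r<k} K + L_k` -/

section Series

variable {F : ℝ → ℝ} {D : ℝ}

/-- `L_k = K_k + L_{k+1}` for `a ≥ 0` (all nice `F`). [cite: Polymath8b2014, §4.5, p. 18, (iak)] -/
theorem Lfun_eq_Kfun_add : ∀ (k : ℕ) {F : ℝ → ℝ} {D : ℝ}, NiceFun F D → ∀ {a : ℝ}, 0 ≤ a →
    Lfun k a F = Kfun k a F + Lfun (k + 1) a F
  | 0, F, D, hF, a, ha => Lfun_zero_eq hF ha
  | k + 1, F, D, hF, a, ha => by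
    rw [Lfun_succ, Lfun_succ, Kfun_succ, peel, peel, peel]
    have hpt : ∀ t ∈ Set.uIcc (0 : ℝ) a, Lfun k (a - t) (fdiff t F) =
        Kfun k (a - t) (fdiff t F) + Lfun (k + 1) (a - t) (fdiff t F) := by
      intro t ht
      rw [Set.uIcc_of_le ha, Set.mem_Icc] at ht
      exact Lfun_eq_Kfun_add k (hF.fdiff t) (by linarith)
    rw [intervalIntegral.integral_congr hpt, intervalIntegral.integral_add
      ((famCont_Kfun k).intervalIntegrable hF a 0 a) ((famCont_Lfun (k + 1)).intervalIntegrable hF a 0 a),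
      add_div]

/-- **`I_a(F) = Σ_{r<k} Kfun r a F + Lfun k a F`** for `a ≥ 0`. [cite: Polymath8b2014, §4.5, p. 18, (iak)] -/
theorem Ifun_eq_sum_Kfun_add_Lfun (hF : NiceFun F D) {a : ℝ} (ha : 0 ≤ a) (k : ℕ) :
    Ifun a F = ∑ r ∈ Finset.range k, Kfun r a F + Lfun k a F := by
  induction k with
  | zero => simp [Lfun_zero]
  | succ k ih => rw [Finset.sum_range_succ, ih, Lfun_eq_Kfun_add k hF ha]; ring

end Series

/-! ### More Fubini-type swaps -/

/-- **Upper triangle**: `∫₀^b ∫_t^b H(s,t) ds dt = ∫₀^b ∫₀^s H(s,t) dt ds` for continuous `H`, `b ≥ 0`. [folklore] -/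
theorem upper_triangle_swap {H : ℝ × ℝ → ℝ} (hH : Continuous H) {b : ℝ} (hb : 0 ≤ b) :
    ∫ t in (0 : ℝ)..b, ∫ s in t..b, H (s, t) = ∫ s in (0 : ℝ)..b, ∫ t in (0 : ℝ)..s, H (s, t) := by
  -- reflect `s ↦ b - σ` inside, swap on the triangle, reflect back outside
  have h1 : ∀ t, ∫ s in t..b, H (s, t) = ∫ σ in (0 : ℝ)..(b - t), H (b - σ, t) := by
    intro t
    rw [intervalIntegral.integral_comp_sub_left (fun s => H (s, t)) b, sub_sub_cancel, sub_zero]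
  simp_rw [h1]
  have h2 := triangle_swap (g := fun p : ℝ × ℝ => H (b - p.1, p.2)) (hH.comp ((continuous_const.sub continuous_fst).prodMk continuous_snd)) hb
  rw [h2]
  have h3 := intervalIntegral.integral_comp_sub_left (fun σ => ∫ t in (0 : ℝ)..(b - σ), H (b - σ, t)) b (a := 0) (b := b)
  simp only [sub_sub_cancel, sub_self, sub_zero] at h3
  rw [← h3]

/-- **Shear and swap**: `∫₀^b ∫₀^{b-t} h(s',t) ds' dt = ∫₀^b ∫₀^s h(s-t,t) dt ds` for continuous `h`, `b ≥ 0`. [folklore] -/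
theorem shear_swap {h : ℝ × ℝ → ℝ} (hh : Continuous h) {b : ℝ} (hb : 0 ≤ b) :
    ∫ t in (0 : ℝ)..b, ∫ s' in (0 : ℝ)..(b - t), h (s', t) = ∫ s in (0 : ℝ)..b, ∫ t in (0 : ℝ)..s, h (s - t, t) := by
  have h1 : ∀ t, ∫ s' in (0 : ℝ)..(b - t), h (s', t) = ∫ s in t..b, h (s - t, t) := by
    intro t
    rw [intervalIntegral.integral_comp_sub_right (fun s' => h (s', t)) t, sub_self]
  simp_rw [h1]
  exact upper_triangle_swap (H := fun p => h (p.1 - p.2, p.2)) (hh.comp ((continuous_fst.sub continuous_snd).prodMk continuous_snd)) hb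

/-! ### Nonnegativity -/

section Nonneg

/-- Peeling preserves nonnegativity on `a ≥ 0`. [folklore] -/
theorem peel_nonneg {Φ : ℝ → (ℝ → ℝ) → ℝ} (h : ∀ (G : ℝ → ℝ) (b : ℝ), 0 ≤ b → 0 ≤ Φ b G) (F : ℝ → ℝ) {a : ℝ}
    (ha : 0 ≤ a) : 0 ≤ peel Φ a F := by
  rw [peel]
  refine div_nonneg (intervalIntegral.integral_nonneg ha fun t ht => h _ _ (by linarith [ht.2])) ha

/-- `Kfun r a F ≥ 0` for `a ≥ 0`. [folklore] -/
theorem Kfun_nonneg : ∀ (r : ℕ) (F : ℝ → ℝ) {a : ℝ}, 0 ≤ a → 0 ≤ Kfun r a F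
  | 0, F, a, ha => by rw [Kfun_zero]; exact div_nonneg (sq_nonneg _) ha
  | r + 1, F, a, ha => by rw [Kfun_succ]; exact peel_nonneg (fun G b hb => Kfun_nonneg r G hb) F ha

/-- `Lfun k a F ≥ 0` for `a ≥ 0`. [folklore] -/
theorem Lfun_nonneg : ∀ (k : ℕ) (F : ℝ → ℝ) {a : ℝ}, 0 ≤ a → 0 ≤ Lfun k a F
  | 0, F, a, ha => by
    rw [Lfun_zero]; exact intervalIntegral.integral_nonneg ha fun u _ => sq_nonneg _
  | k + 1, F, a, ha => by rw [Lfun_succ]; exact peel_nonneg (fun G b hb => Lfun_nonneg k G hb) F ha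

/-- `Σ_{r<k} K_r(a) ≤ I_a`. [cite: Polymath8b2014, §4.5, p. 18, (kbound-lower)] -/
theorem sum_Kfun_le_Ifun {F : ℝ → ℝ} {D : ℝ} (hF : NiceFun F D) {a : ℝ} (ha : 0 ≤ a) (k : ℕ) :
    ∑ r ∈ Finset.range k, Kfun r a F ≤ Ifun a F := by
  rw [Ifun_eq_sum_Kfun_add_Lfun hF ha k]
  linarith [Lfun_nonneg k F ha]

end Nonneg

/-! ### `L_k → 0` (p. 19) -/

section Lzero

variable {F : ℝ → ℝ} {D D' : ℝ}

/-- Translation commutes with differences. [folklore] -/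
theorem translate_fdiff (u t : ℝ) (G : ℝ → ℝ) : translate u (fdiff t G) = fdiff t (translate u G) := by
  funext v; simp [translate, fdiff]; ring_nf

/-- The comparison functional `R_k(a;F) = ∫₀^a ∫₀^{a-u} Kfun k s (τ_u F') ds du`. [cite: Polymath8b2014, §4.5, p. 19] -/
def Rfun (k : ℕ) (a : ℝ) (F : ℝ → ℝ) : ℝ :=
  ∫ u in (0 : ℝ)..a, ∫ s in (0 : ℝ)..(a - u), Kfun k s (translate u (deriv F))

/-- Continuity of `(u, s) ↦ Kfun k s (τ_u G)`. [folklore] -/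
theorem continuous_Kfun_translate (k : ℕ) {G : ℝ → ℝ} {D : ℝ} (hG : NiceFun G D) :
    Continuous (fun p : ℝ × ℝ => Kfun k p.2 (translate p.1 G)) :=
  ((famCont_Kfun k).continuous_translate hG).comp (continuous_snd.prodMk continuous_fst)

/-- Continuity of `(t, u, s) ↦ Kfun k s (∂_{(t)} τ_u G)`. [folklore] -/
theorem continuous_Kfun_fdiff_translate (k : ℕ) {G : ℝ → ℝ} {D : ℝ} (hG : NiceFun G D) :
    Continuous (fun p : ℝ × ℝ × ℝ => Kfun k p.2.2 (fdiff p.1 (translate p.2.1 G))) := by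
  have h := famCont_Kfun k hG 1
  have e : ∀ p : ℝ × ℝ × ℝ, fdiff p.1 (translate p.2.1 G) = dIterV 1 (Fin.cons p.1 Fin.elim0) (translate p.2.1 G) :=
    fun p => by rw [dIterV_cons]; rfl
  simp_rw [e]
  exact h.comp (Continuous.prodMk (continuous_snd.comp continuous_snd)
    (Continuous.prodMk (continuous_finCons.comp (continuous_fst.prodMk continuous_const))
      (continuous_fst.comp continuous_snd)))

/-- **Base case**: `Lfun 1 a F ≤ R_0(a; F)`. [cite: Polymath8b2014, §4.5, p. 19] -/
theorem Lfun_one_le_Rfun (hF : NiceFun F D) (hF' : NiceFun (deriv F) D') {a : ℝ} (ha : 0 ≤ a) :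
    Lfun 1 a F ≤ Rfun 0 a F := by
  set f := deriv F with hf
  have hfc : Continuous f := hF.continuous_deriv
  -- `N(u, s) = (f(u+s) - f(u))²`
  have hN : Continuous fun p : ℝ × ℝ => (f (p.1 + p.2) - f p.1) ^ 2 :=
    ((hfc.comp (continuous_fst.add continuous_snd)).sub (hfc.comp continuous_fst)).pow 2
  -- the left side: `(1/a) ∫₀^a ∫₀^{a-s} N(u,s) du ds`
  have hL : Lfun 1 a F = (∫ s in (0 : ℝ)..a, ∫ u in (0 : ℝ)..(a - s), (f (u + s) - f u) ^ 2) / a := by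
    rw [Lfun_succ, peel, Lfun_zero]
    congr 1
    refine intervalIntegral.integral_congr fun s _ => ?_
    simp only [Ifun, hF.deriv_fdiff s, fdiff_apply]
    rfl
  -- the right side after swapping: `∫₀^a ∫₀^{a-s} N(u,s)/s du ds`
  have hR : Rfun 0 a F = ∫ s in (0 : ℝ)..a, ∫ u in (0 : ℝ)..(a - s), (f (u + s) - f u) ^ 2 / s := by
    rw [Rfun]
    have hsw := triangle_swap (g := fun p : ℝ × ℝ => Kfun 0 p.1 (translate p.2 f))
      ((continuous_Kfun_translate 0 hF').comp (continuous_snd.prodMk continuous_fst)) ha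
    -- `Rfun = ∫_u ∫_s K(s, τ_u f)`; `triangle_swap` is stated as `∫_t ∫_u g(u,t) = ∫_u ∫_t g(u,t)`
    rw [← hf]
    calc ∫ u in (0 : ℝ)..a, ∫ s in (0 : ℝ)..(a - u), Kfun 0 s (translate u f)
        = ∫ s in (0 : ℝ)..a, ∫ u in (0 : ℝ)..(a - s), Kfun 0 s (translate u f) := hsw
      _ = _ := by
          refine intervalIntegral.integral_congr fun s _ => intervalIntegral.integral_congr fun u _ => ?_
          simp only [Kfun_zero, Jfun, translate_apply, zero_add]
          ring_nf
  rw [hL, hR]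
  rcases eq_or_lt_of_le ha with rfl | ha0
  · simp
  rw [div_le_iff₀ ha0, ← intervalIntegral.integral_mul_const]
  -- compare integrands on `[0, a]`
  have hIn : ∀ s, Continuous fun u => (f (u + s) - f u) ^ 2 := fun s =>
    ((hfc.comp (continuous_id.add continuous_const)).sub hfc).pow 2
  have c1 : Continuous fun s => ∫ u in (0 : ℝ)..(a - s), (f (u + s) - f u) ^ 2 :=
    intervalIntegral.continuous_parametric_intervalIntegral_of_continuous (f := fun s u => (f (u + s) - f u) ^ 2)
      (hN.comp (continuous_snd.prodMk continuous_fst)) (continuous_const.sub continuous_id)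
  have c2 : Continuous fun s => ∫ u in (0 : ℝ)..(a - s), Kfun 0 s (translate u f) :=
    intervalIntegral.continuous_parametric_intervalIntegral_of_continuous (f := fun s u => Kfun 0 s (translate u f))
      ((continuous_Kfun_translate 0 hF').comp (continuous_snd.prodMk continuous_fst)) (continuous_const.sub continuous_id)
  have e2 : ∀ s, ∫ u in (0 : ℝ)..(a - s), (f (u + s) - f u) ^ 2 / s = ∫ u in (0 : ℝ)..(a - s), Kfun 0 s (translate u f) := by
    intro s
    refine intervalIntegral.integral_congr fun u _ => ?_
    simp only [Kfun_zero, Jfun, translate_apply, zero_add]; ring_nf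
  refine intervalIntegral.integral_mono_on ha (c1.intervalIntegrable _ _) ?_ fun s hs => ?_
  · simp_rw [e2]; exact (c2.mul continuous_const).intervalIntegrable _ _
  · obtain ⟨hs0, hsa⟩ := hs
    have hint0 : 0 ≤ ∫ u in (0 : ℝ)..(a - s), (f (u + s) - f u) ^ 2 :=
      intervalIntegral.integral_nonneg (by linarith) fun u _ => sq_nonneg _
    rcases eq_or_lt_of_le hs0 with rfl | hs0'
    · -- `s = 0`: the integrand `(f(u+0) - f(u))² = 0`
      have : ∫ u in (0 : ℝ)..(a - 0), (f (u + 0) - f u) ^ 2 = 0 := by simp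
      rw [this]
      have : ∫ u in (0 : ℝ)..(a - 0), (f (u + 0) - f u) ^ 2 / 0 = 0 := by simp
      rw [this]; simp
    · rw [← intervalIntegral.integral_mul_const]
      refine intervalIntegral.integral_mono_on (by linarith) ((hIn s).intervalIntegrable _ _)
        (((hIn s).div_const s).mul continuous_const |>.intervalIntegrable _ _) fun u _ => ?_
      rw [div_mul_eq_mul_div, le_div_iff₀ hs0']
      exact mul_le_mul_of_nonneg_left hsa (sq_nonneg _)

/-- **Induction step**: if `Lfun (k+1) b G ≤ R_k(b;G)` for all nice `G` (with nice derivative) and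
`b ≥ 0`, then the same holds with `k+1`. [cite: Polymath8b2014, §4.5, p. 19] -/
theorem Lfun_le_Rfun_step (k : ℕ)
    (ih : ∀ {G : ℝ → ℝ} {E E' : ℝ}, NiceFun G E → NiceFun (deriv G) E' → ∀ {b : ℝ}, 0 ≤ b → Lfun (k + 1) b G ≤ Rfun k b G)
    (hF : NiceFun F D) (hF' : NiceFun (deriv F) D') {a : ℝ} (ha : 0 ≤ a) :
    Lfun (k + 2) a F ≤ Rfun (k + 1) a F := by
  set f := deriv F with hf
  rcases eq_or_lt_of_le ha with rfl | ha0
  · simp [Lfun_succ, peel, Rfun]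
  -- Step 1: `Lfun (k+2) a F ≤ (1/a) ∫₀^a R_k(a-t; ∂_t F) dt`
  have hcontL : Continuous fun t => Lfun (k + 1) (a - t) (fdiff t F) :=
    (famCont_Lfun (k + 1)).continuous_peelIntegrand hF a
  -- the triple integrand `(t, u, s) ↦ Kfun k s (∂_t τ_u f)`
  have hK3 := continuous_Kfun_fdiff_translate k hF'
  have hinner : Continuous fun q : ℝ × ℝ => ∫ s in (0 : ℝ)..(a - q.1 - q.2), Kfun k s (fdiff q.1 (translate q.2 f)) :=
    intervalIntegral.continuous_parametric_intervalIntegral_of_continuous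
      (f := fun (q : ℝ × ℝ) s => Kfun k s (fdiff q.1 (translate q.2 f)))
      (hK3.comp ((continuous_fst.comp continuous_fst).prodMk
        ((continuous_snd.comp continuous_fst).prodMk continuous_snd)))
      ((continuous_const.sub continuous_fst).sub continuous_snd)
  have hRt : ∀ t, Rfun k (a - t) (fdiff t F) =
      ∫ u in (0 : ℝ)..(a - t), ∫ s in (0 : ℝ)..(a - t - u), Kfun k s (fdiff t (translate u f)) := by
    intro t
    rw [Rfun, hF.deriv_fdiff t]
    refine intervalIntegral.integral_congr fun u _ => intervalIntegral.integral_congr fun s _ => ?_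
    simp only [translate_fdiff, hf]
  have hcontR : Continuous fun t => Rfun k (a - t) (fdiff t F) := by
    simp_rw [hRt]
    exact intervalIntegral.continuous_parametric_intervalIntegral_of_continuous
      (f := fun t u => ∫ s in (0 : ℝ)..(a - t - u), Kfun k s (fdiff t (translate u f))) hinner
      (continuous_const.sub continuous_id)
  have step1 : Lfun (k + 2) a F ≤ (∫ t in (0 : ℝ)..a, Rfun k (a - t) (fdiff t F)) / a := by
    rw [Lfun_succ, peel]
    refine div_le_div_of_nonneg_right ?_ ha
    refine intervalIntegral.integral_mono_on ha (hcontL.intervalIntegrable _ _) (hcontR.intervalIntegrable _ _)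
      fun t ht => ?_
    have := ih (hF.fdiff t) (G := fdiff t F) (E' := D' + D') (by rw [hF.deriv_fdiff t]; exact hF'.fdiff t)
      (b := a - t) (by linarith [ht.2])
    exact this
  refine step1.trans ?_
  -- Step 2: rewrite the bound as a triple integral and swap `t` and `u`
  simp_rw [hRt]
  have hsw := triangle_swap (g := fun p : ℝ × ℝ => ∫ s in (0 : ℝ)..(a - p.2 - p.1), Kfun k s (fdiff p.2 (translate p.1 f)))
    (hinner.comp (continuous_snd.prodMk continuous_fst)) ha
  -- `hsw : ∫_t ∫_{u ≤ a-t} g(u,t) = ∫_u ∫_{t ≤ a-u} g(u,t)`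
  simp only at hsw
  rw [hsw, div_le_iff₀ ha0, Rfun, ← intervalIntegral.integral_mul_const]
  -- Step 3: compare the `u`-integrands on `[0,a]`
  have cL : Continuous fun u => (∫ t in (0 : ℝ)..(a - u), ∫ s in (0 : ℝ)..(a - t - u),
      Kfun k s (fdiff t (translate u f))) :=
    intervalIntegral.continuous_parametric_intervalIntegral_of_continuous
      (f := fun u t => ∫ s in (0 : ℝ)..(a - t - u), Kfun k s (fdiff t (translate u f)))
      (hinner.comp (continuous_snd.prodMk continuous_fst)) (continuous_const.sub continuous_id)
  have cR : Continuous fun u => ∫ s in (0 : ℝ)..(a - u), Kfun (k + 1) s (translate u (deriv F)) :=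
    intervalIntegral.continuous_parametric_intervalIntegral_of_continuous
      (f := fun u s => Kfun (k + 1) s (translate u (deriv F)))
      (continuous_Kfun_translate (k + 1) hF') (continuous_const.sub continuous_id)
  refine intervalIntegral.integral_mono_on ha (cL.intervalIntegrable _ _) ((cR.mul continuous_const).intervalIntegrable _ _)
    fun u hu => ?_
  obtain ⟨hu0, hua⟩ := hu
  set b := a - u with hb
  have hb0 : 0 ≤ b := by linarith
  set G := translate u f with hG
  have hGn : NiceFun G D' := hF'.translate u
  -- shear and swap in `(t, s)`: `∫_{t≤b} ∫_{s'≤b-t} K(s', ∂_t G) = ∫_{s ≤ b} ∫_{t ≤ s} K(s-t, ∂_t G)`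
  have hK2 : Continuous fun p : ℝ × ℝ => Kfun k p.1 (fdiff p.2 G) :=
    hK3.comp (continuous_snd.prodMk ((continuous_const (y := u)).prodMk continuous_fst))
  have e1 : ∀ t, ∫ s in (0 : ℝ)..(a - t - u), Kfun k s (fdiff t G) =
      ∫ s in (0 : ℝ)..(b - t), Kfun k s (fdiff t G) := by
    intro t; rw [hb]; congr 1; ring
  simp_rw [e1]
  rw [shear_swap (h := fun p : ℝ × ℝ => Kfun k p.1 (fdiff p.2 G)) hK2 hb0]
  -- compare `s`-integrands on `[0, b]`: `∫_{t≤s} K(s-t, ∂_t G) ≤ a · Kfun (k+1) s G = a (1/s) ∫_{t≤s} K(s-t,∂_tG)`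
  rw [← intervalIntegral.integral_mul_const]
  have cL2 : Continuous fun s => ∫ t in (0 : ℝ)..s, Kfun k (s - t) (fdiff t G) :=
    intervalIntegral.continuous_parametric_intervalIntegral_of_continuous
      (f := fun s t => Kfun k (s - t) (fdiff t G))
      (hK2.comp ((continuous_fst.sub continuous_snd).prodMk continuous_snd)) continuous_id
  have cR2 : Continuous fun s => Kfun (k + 1) s G * a :=
    ((famCont_Kfun (k + 1)).continuous_in_a hGn).mul continuous_const
  refine intervalIntegral.integral_mono_on hb0 (cL2.intervalIntegrable _ _) (cR2.intervalIntegrable _ _) fun s hs => ?_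
  obtain ⟨hs0, hsb⟩ := hs
  rw [Kfun_succ, peel]
  have hint0 : 0 ≤ ∫ t in (0 : ℝ)..s, Kfun k (s - t) (fdiff t G) :=
    intervalIntegral.integral_nonneg hs0 fun t ht => Kfun_nonneg k _ (by linarith [ht.2])
  rcases eq_or_lt_of_le hs0 with rfl | hs0'
  · simp
  · rw [div_mul_eq_mul_div, le_div_iff₀ hs0']
    exact mul_le_mul_of_nonneg_left (by linarith) hint0

/-- **`Lfun (k+1) a F ≤ R_k(a; F)`** for all `k`, `a ≥ 0`, nice `F` with nice derivative. [cite: Polymath8b2014, §4.5, p. 19] -/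
theorem Lfun_succ_le_Rfun : ∀ (k : ℕ) {F : ℝ → ℝ} {D D' : ℝ}, NiceFun F D → NiceFun (deriv F) D' →
    ∀ {a : ℝ}, 0 ≤ a → Lfun (k + 1) a F ≤ Rfun k a F
  | 0, _, _, _, hF, hF', _, ha => Lfun_one_le_Rfun hF hF' ha
  | k + 1, _, _, _, hF, hF', _, ha =>
    Lfun_le_Rfun_step k (fun hG hG' _ hb => Lfun_succ_le_Rfun k hG hG' hb) hF hF' ha

/-- **`Σ_{k<K} R_k(a; F) ≤ D'² a³`** (via `Σ_r K_r ≤ I`). [cite: Polymath8b2014, §4.5, p. 19, (krsum)] -/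
theorem sum_Rfun_le (hF' : NiceFun (deriv F) D') {a : ℝ} (ha : 0 ≤ a) (K : ℕ) :
    ∑ k ∈ Finset.range K, Rfun k a F ≤ D' ^ 2 * a ^ 3 := by
  set f := deriv F with hf
  -- each `R_k` is a double integral of a continuous function; sum inside
  have hc : ∀ k, Continuous fun p : ℝ × ℝ => Kfun k p.2 (translate p.1 f) := fun k => continuous_Kfun_translate k hF'
  have hin : ∀ k u, IntervalIntegrable (fun s => Kfun k s (translate u f)) volume 0 (a - u) := fun k u =>
    ((hc k).comp (continuous_const.prodMk continuous_id)).intervalIntegrable _ _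
  have hout : ∀ k, IntervalIntegrable (fun u => ∫ s in (0 : ℝ)..(a - u), Kfun k s (translate u f)) volume 0 a :=
    fun k => (intervalIntegral.continuous_parametric_intervalIntegral_of_continuous
      (f := fun u s => Kfun k s (translate u f)) (hc k)
      (continuous_const.sub continuous_id)).intervalIntegrable _ _
  have hsum : ∑ k ∈ Finset.range K, Rfun k a F =
      ∫ u in (0 : ℝ)..a, ∫ s in (0 : ℝ)..(a - u), ∑ k ∈ Finset.range K, Kfun k s (translate u f) := by
    simp only [Rfun, ← hf]
    rw [← intervalIntegral.integral_finsetSum (fun k _ => hout k)]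
    refine intervalIntegral.integral_congr fun u _ => ?_
    rw [← intervalIntegral.integral_finsetSum (fun k _ => hin k u)]
  rw [hsum]
  -- bound the inner sums by `I_s(τ_u f) ≤ D'² s ≤ D'² a`
  have hbound : ∀ u ∈ Set.Icc (0 : ℝ) a, ∫ s in (0 : ℝ)..(a - u), ∑ k ∈ Finset.range K, Kfun k s (translate u f) ≤
      D' ^ 2 * a ^ 2 := by
    intro u hu
    have hτ : NiceFun (translate u f) D' := hF'.translate u
    have h1 : ∀ s ∈ Set.Icc (0 : ℝ) (a - u), ∑ k ∈ Finset.range K, Kfun k s (translate u f) ≤ D' ^ 2 * a := by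
      intro s hs
      refine (sum_Kfun_le_Ifun hτ hs.1 K).trans ?_
      have := famBound_Lfun_zero hτ s
      rw [Lfun_zero] at this
      calc Ifun s (translate u f) ≤ |Ifun s (translate u f)| := le_abs_self _
        _ ≤ 1 * D' ^ 2 * |s| := this
        _ ≤ D' ^ 2 * a := by
            rw [one_mul, abs_of_nonneg hs.1]
            exact mul_le_mul_of_nonneg_left (by linarith [hs.2, hu.1]) (sq_nonneg _)
    have hci : Continuous fun s => ∑ k ∈ Finset.range K, Kfun k s (translate u f) :=
      continuous_finsetSum _ fun k _ => (hc k).comp (continuous_const.prodMk continuous_id)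
    calc ∫ s in (0 : ℝ)..(a - u), ∑ k ∈ Finset.range K, Kfun k s (translate u f)
        ≤ ∫ s in (0 : ℝ)..(a - u), D' ^ 2 * a :=
          intervalIntegral.integral_mono_on (by linarith [hu.2]) (hci.intervalIntegrable _ _) intervalIntegrable_const h1
      _ = (a - u) * (D' ^ 2 * a) := by rw [intervalIntegral.integral_const, smul_eq_mul, sub_zero]
      _ ≤ a * (D' ^ 2 * a) := mul_le_mul_of_nonneg_right (by linarith [hu.1]) (by positivity)
      _ = D' ^ 2 * a ^ 2 := by ring
  have hco : Continuous fun u => ∫ s in (0 : ℝ)..(a - u), ∑ k ∈ Finset.range K, Kfun k s (translate u f) := by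
    have : Continuous fun p : ℝ × ℝ => ∑ k ∈ Finset.range K, Kfun k p.2 (translate p.1 f) :=
      continuous_finsetSum _ fun k _ => hc k
    exact intervalIntegral.continuous_parametric_intervalIntegral_of_continuous
      (f := fun u s => ∑ k ∈ Finset.range K, Kfun k s (translate u f)) this (continuous_const.sub continuous_id)
  calc ∫ u in (0 : ℝ)..a, ∫ s in (0 : ℝ)..(a - u), ∑ k ∈ Finset.range K, Kfun k s (translate u f)
      ≤ ∫ u in (0 : ℝ)..a, D' ^ 2 * a ^ 2 :=
        intervalIntegral.integral_mono_on ha (hco.intervalIntegrable _ _) intervalIntegrable_const hbound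
    _ = D' ^ 2 * a ^ 3 := by rw [intervalIntegral.integral_const, smul_eq_mul, sub_zero]; ring

/-- **`L_k(a; F) → 0`** as `k → ∞` (`a ≥ 0`, `F` nice with nice derivative). [cite: Polymath8b2014, §4.5, p. 19] -/
theorem tendsto_Lfun_atTop (hF : NiceFun F D) (hF' : NiceFun (deriv F) D') {a : ℝ} (ha : 0 ≤ a) :
    Tendsto (fun k => Lfun k a F) atTop (𝓝 0) := by
  -- the shifted sequence `k ↦ Lfun (k+1) a F` is nonnegative with bounded partial sums
  have hnn : ∀ k, 0 ≤ Lfun (k + 1) a F := fun k => Lfun_nonneg _ F ha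
  have hbd : ∀ K, ∑ k ∈ Finset.range K, Lfun (k + 1) a F ≤ D' ^ 2 * a ^ 3 := fun K =>
    (Finset.sum_le_sum fun k _ => Lfun_succ_le_Rfun k hF hF' ha).trans (sum_Rfun_le hF' ha K)
  have hs : Summable fun k => Lfun (k + 1) a F := summable_of_sum_range_le hnn hbd
  have h := hs.tendsto_atTop_zero
  exact (tendsto_add_atTop_iff_nat 1).1 h

/-- **The depolarised identity** `I_a(F) = Σ_r K_r(a;F)`: the partial sums converge to `I_a(F)`. [cite: Polymath8b2014, §4.5, p. 18, (depol-2)] -/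
theorem tendsto_sum_Kfun (hF : NiceFun F D) (hF' : NiceFun (deriv F) D') {a : ℝ} (ha : 0 ≤ a) :
    Tendsto (fun k => ∑ r ∈ Finset.range k, Kfun r a F) atTop (𝓝 (Ifun a F)) := by
  have h : ∀ k, ∑ r ∈ Finset.range k, Kfun r a F = Ifun a F - Lfun k a F := fun k => by
    rw [Ifun_eq_sum_Kfun_add_Lfun hF ha k]; ring
  simp_rw [h]
  have := (tendsto_Lfun_atTop hF hF' ha).const_sub (Ifun a F)
  simpa using this

end Lzero

/-! ### The truncated constants converge to `K` (monotone/dominated convergence) -/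

section Trunc

variable {F : ℝ → ℝ} {D : ℝ}

/-- Bounded measurable functions are interval integrable. [folklore] -/
theorem intervalIntegrable_of_bounded {f : ℝ → ℝ} (hf : Measurable f) (b₁ b₂ C : ℝ)
    (hb : ∀ t ∈ Ι b₁ b₂, |f t| ≤ C) : IntervalIntegrable f volume b₁ b₂ := by
  rw [intervalIntegrable_iff]
  refine IntegrableOn.of_bound ?_ hf.aestronglyMeasurable C ?_
  · rw [Set.uIoc, Real.volume_Ioc]; exact ENNReal.ofReal_lt_top
  · rw [ae_restrict_iff' measurableSet_uIoc]
    exact Eventually.of_forall fun t ht => by rw [Real.norm_eq_abs]; exact hb t ht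

/-- Points of `Ι b₁ b₂` are bounded by `max |b₁| |b₂|`. [folklore] -/
theorem abs_le_of_mem_uIoc {b₁ b₂ t : ℝ} (ht : t ∈ Ι b₁ b₂) : |t| ≤ max |b₁| |b₂| := by
  rcases Set.mem_uIoc.1 ht with ⟨h1, h2⟩ | ⟨h1, h2⟩
  · rw [abs_le]; constructor
    · have := neg_abs_le b₁; linarith [le_max_left |b₁| |b₂|]
    · exact h2.trans ((le_abs_self _).trans (le_max_right _ _))
  · rw [abs_le]; constructor
    · have := neg_abs_le b₂; linarith [le_max_right |b₁| |b₂|]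
    · exact h2.trans ((le_abs_self _).trans (le_max_left _ _))

/-- The base `M`-integrand is an indicator times the `K`-integrand. [folklore] -/
theorem Mfun_zero_integrand_eq (ε a : ℝ) (F : ℝ → ℝ) :
    (fun t => Mfun ε 0 (a - t) (fdiff t F)) = (Set.Iic (a - ε)).indicator (fun t => Kfun 0 (a - t) (fdiff t F)) := by
  funext t
  rw [Mfun_zero, Kfun_zero]
  simp only [Set.indicator_apply, Set.mem_Iic]
  by_cases h : t ≤ a - ε
  · rw [if_pos (by linarith : ε ≤ a - t), if_pos h]
  · rw [if_neg (by push Not at h ⊢; linarith), if_neg h]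

/-- Measurability of the peeling integrand of `Mfun ε r`. [folklore] -/
theorem measurable_Mfun_integrand {ε : ℝ} (hε : 0 < ε) (hF : NiceFun F D) (a : ℝ) :
    ∀ r : ℕ, Measurable fun t => Mfun ε r (a - t) (fdiff t F)
  | 0 => by
    rw [Mfun_zero_integrand_eq]
    exact ((famCont_Kfun 0).continuous_peelIntegrand hF a).measurable.indicator measurableSet_Iic
  | r + 1 => ((famCont_Mfun_succ hε r).continuous_peelIntegrand hF a).measurable

/-- `Mfun ε 1 = peelT ε (Mfun ε 0)` at nice `F`, for `ε > 0`. [folklore] -/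
theorem Mfun_one_eq_peelT {ε : ℝ} (hε : 0 < ε) (hF : NiceFun F D) (a : ℝ) :
    Mfun ε 1 a F = peelT ε (Mfun ε 0) a F := by
  rw [Mfun_one, peelT]
  simp only
  congr 1
  have hKc : Continuous fun t => Kfun 0 (a - t) (fdiff t F) := (famCont_Kfun 0).continuous_peelIntegrand hF a
  have hM0 : ∀ t, a - ε < t → Mfun ε 0 (a - t) (fdiff t F) = 0 := by
    intro t ht; rw [Mfun_zero]; simp only; rw [if_neg (by linarith)]
  have hMK : ∀ t, t ≤ a - ε → Mfun ε 0 (a - t) (fdiff t F) = Kfun 0 (a - t) (fdiff t F) := by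
    intro t ht; rw [Mfun_zero, Kfun_zero]; simp only; rw [if_pos (by linarith)]
  by_cases ha : a - ε ≤ ε
  · -- both vanish
    rw [max_eq_left ha, intervalIntegral.integral_same]
    by_cases ha' : a ≤ ε
    · rw [max_eq_left ha', intervalIntegral.integral_same]
    · push Not at ha'
      rw [max_eq_right ha'.le, intervalIntegral.integral_of_le ha'.le]
      symm
      refine setIntegral_eq_zero_of_forall_eq_zero fun t ht => hM0 t ?_
      exact lt_of_le_of_lt ha ht.1
  · push Not at ha
    have ha' : ε ≤ a := by linarith
    rw [max_eq_right ha.le, max_eq_right ha']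
    -- split the right integral at `a - ε`
    have hi : ∀ b₁ b₂, IntervalIntegrable (fun t => Mfun ε 0 (a - t) (fdiff t F)) volume b₁ b₂ := by
      intro b₁ b₂
      obtain ⟨C, hC⟩ := (isCompact_uIcc (a := b₁) (b := b₂)).exists_bound_of_continuousOn hKc.continuousOn
      have hm : Measurable fun t => Mfun ε 0 (a - t) (fdiff t F) := by
        rw [Mfun_zero_integrand_eq]; exact hKc.measurable.indicator measurableSet_Iic
      refine intervalIntegrable_of_bounded hm b₁ b₂ |C| fun t ht => ?_
      by_cases h : t ≤ a - ε
      · rw [hMK t h]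
        have := hC t (Set.uIoc_subset_uIcc ht); rw [Real.norm_eq_abs] at this; exact this.trans (le_abs_self C)
      · rw [hM0 t (by push Not at h; exact h), abs_zero]; exact abs_nonneg C
    rw [← intervalIntegral.integral_add_adjacent_intervals (hi ε (a - ε)) (hi (a - ε) a)]
    have h1 : ∫ t in ε..(a - ε), Mfun ε 0 (a - t) (fdiff t F) = ∫ t in ε..(a - ε), Kfun 0 (a - t) (fdiff t F) :=
      intervalIntegral.integral_congr fun t ht => hMK t (by rw [Set.uIcc_of_le ha.le] at ht; exact ht.2)
    have h2 : ∫ t in (a - ε)..a, Mfun ε 0 (a - t) (fdiff t F) = 0 := by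
      rw [intervalIntegral.integral_of_le (by linarith)]
      exact setIntegral_eq_zero_of_forall_eq_zero fun t ht => hM0 t ht.1
    rw [h1, h2, add_zero]

/-- `Mfun ε (r+1) a F = peelT ε (Mfun ε r) a F` for all `r` (`ε > 0`, nice `F`). [folklore] -/
theorem Mfun_succ_eq_peelT {ε : ℝ} (hε : 0 < ε) (hF : NiceFun F D) (a : ℝ) :
    ∀ r : ℕ, Mfun ε (r + 1) a F = peelT ε (Mfun ε r) a F
  | 0 => Mfun_one_eq_peelT hε hF a
  | r + 1 => by rw [Mfun_succ_succ]

/-- The `M`-integrand is interval integrable. [folklore] -/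
theorem intervalIntegrable_Mfun_integrand {ε : ℝ} (hε : 0 < ε) (hF : NiceFun F D) (a : ℝ) (r : ℕ) (b₁ b₂ : ℝ) :
    IntervalIntegrable (fun t => Mfun ε r (a - t) (fdiff t F)) volume b₁ b₂ := by
  have hb : FamBound (Mfun ε r) (4 ^ r) := by
    rcases r with _ | r
    · simpa using famBound_Mfun_zero ε
    · exact famBound_Mfun_succ hε.le r
  refine intervalIntegrable_of_bounded (measurable_Mfun_integrand hε hF a r) b₁ b₂
    (4 ^ r * (D + D) ^ 2 * (|a| + max |b₁| |b₂|)) fun t ht => ?_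
  refine (hb (hF.fdiff t) (a - t)).trans (mul_le_mul_of_nonneg_left ?_ (by have := hF.nonneg; positivity))
  exact (abs_sub _ _).trans (add_le_add le_rfl (abs_le_of_mem_uIoc ht))

/-- **`0 ≤ Mfun ε r a F ≤ Kfun r a F`** for `a ≥ 0`, `ε > 0`. [folklore] -/
theorem Mfun_nonneg_le_Kfun {ε : ℝ} (hε : 0 < ε) :
    ∀ (r : ℕ) {F : ℝ → ℝ} {D : ℝ}, NiceFun F D → ∀ {a : ℝ}, 0 ≤ a → 0 ≤ Mfun ε r a F ∧ Mfun ε r a F ≤ Kfun r a F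
  | 0, F, D, hF, a, ha => by
    rw [Mfun_zero]
    simp only
    split_ifs
    · exact ⟨Kfun_nonneg 0 F ha, le_rfl⟩
    · exact ⟨le_rfl, Kfun_nonneg 0 F ha⟩
  | r + 1, F, D, hF, a, ha => by
    rw [Mfun_succ_eq_peelT hε hF a r, peelT, Kfun_succ, peel]
    have hKi : IntervalIntegrable (fun t => Kfun r (a - t) (fdiff t F)) volume 0 a :=
      (famCont_Kfun r).intervalIntegrable hF a 0 a
    have hMi := intervalIntegrable_Mfun_integrand hε hF a r
    by_cases hεa : a ≤ ε
    · rw [max_eq_left hεa, intervalIntegral.integral_same, zero_div]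
      exact ⟨le_rfl, div_nonneg (intervalIntegral.integral_nonneg ha fun t ht =>
        Kfun_nonneg r _ (by linarith [ht.2])) ha⟩
    · push Not at hεa
      rw [max_eq_right hεa.le]
      have hM0 : 0 ≤ ∫ t in ε..a, Mfun ε r (a - t) (fdiff t F) :=
        intervalIntegral.integral_nonneg hεa.le fun t ht =>
          (Mfun_nonneg_le_Kfun hε r (hF.fdiff t) (a := a - t) (by linarith [ht.2])).1
      refine ⟨div_nonneg hM0 ha, div_le_div_of_nonneg_right ?_ ha⟩
      calc ∫ t in ε..a, Mfun ε r (a - t) (fdiff t F) ≤ ∫ t in ε..a, Kfun r (a - t) (fdiff t F) :=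
            intervalIntegral.integral_mono_on hεa.le (hMi ε a) ((famCont_Kfun r).intervalIntegrable hF a ε a)
              fun t ht => (Mfun_nonneg_le_Kfun hε r (hF.fdiff t) (a := a - t) (by linarith [ht.2])).2
        _ ≤ ∫ t in (0 : ℝ)..a, Kfun r (a - t) (fdiff t F) := by
            refine intervalIntegral.integral_mono_interval hε.le hεa.le le_rfl ?_ hKi
            rw [EventuallyLE, ae_restrict_iff' measurableSet_Ioc]
            exact Eventually.of_forall fun t ht => Kfun_nonneg r _ (by linarith [ht.2])

/-- `∫_ε^a g = ∫₀^a 1_{(ε,∞)} g` for `0 ≤ ε ≤ a`. [folklore] -/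
theorem integral_eq_integral_indicator_Ioi {g : ℝ → ℝ} {ε a : ℝ} (hε : 0 ≤ ε) (hεa : ε ≤ a) :
    ∫ t in ε..a, g t = ∫ t in (0 : ℝ)..a, (Set.Ioi ε).indicator g t := by
  rw [intervalIntegral.integral_of_le hεa, intervalIntegral.integral_of_le (hε.trans hεa),
    setIntegral_indicator measurableSet_Ioi]
  have : Set.Ioc 0 a ∩ Set.Ioi ε = Set.Ioc ε a := by
    ext t; simp only [Set.mem_inter_iff, Set.mem_Ioc, Set.mem_Ioi]; constructor
    · rintro ⟨⟨-, h2⟩, h3⟩; exact ⟨h3, h2⟩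
    · rintro ⟨h1, h2⟩; exact ⟨⟨by linarith, h2⟩, h1⟩
  rw [this]

/-- **`Mfun ε r a F → Kfun r a F`** as `ε → 0⁺` (`a > 0`, all nice `F`). [cite: Polymath8b2014, §4.5, p. 18] -/
theorem tendsto_Mfun : ∀ (r : ℕ) {F : ℝ → ℝ} {D : ℝ}, NiceFun F D → ∀ {a : ℝ}, 0 < a →
    Tendsto (fun ε => Mfun ε r a F) (𝓝[>] 0) (𝓝 (Kfun r a F))
  | 0, F, D, hF, a, ha => by
    refine (tendsto_const_nhds (x := Kfun 0 a F)).congr' ?_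
    filter_upwards [Ioo_mem_nhdsGT ha] with ε hε
    rw [Mfun_zero, Kfun_zero]
    simp only [if_pos hε.2.le]
  | r + 1, F, D, hF, a, ha => by
    have hD := hF.nonneg
    -- dominated convergence for `ε ↦ ∫₀^a 1_{(ε,∞)}(t) Mfun ε r (a-t) (∂_t F) dt`
    set C : ℝ := 4 ^ r * (D + D) ^ 2 * (|a| + max |(0 : ℝ)| |a|) with hC
    have hb : ∀ {ε : ℝ}, 0 < ε → FamBound (Mfun ε r) (4 ^ r) := by
      intro ε hε
      rcases r with _ | r
      · simpa using famBound_Mfun_zero ε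
      · exact famBound_Mfun_succ hε.le r
    have key : Tendsto (fun ε => ∫ t in (0 : ℝ)..a, (Set.Ioi ε).indicator (fun t => Mfun ε r (a - t) (fdiff t F)) t)
        (𝓝[>] 0) (𝓝 (∫ t in (0 : ℝ)..a, Kfun r (a - t) (fdiff t F))) := by
      refine intervalIntegral.tendsto_integral_filter_of_dominated_convergence (fun _ => C) ?_ ?_
        intervalIntegrable_const ?_
      · filter_upwards [self_mem_nhdsWithin] with ε (hε : 0 < ε)
        exact ((measurable_Mfun_integrand hε hF a r).indicator measurableSet_Ioi).aestronglyMeasurable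
      · filter_upwards [self_mem_nhdsWithin] with ε (hε : 0 < ε)
        refine Eventually.of_forall fun t ht => ?_
        rw [Real.norm_eq_abs, Set.indicator_apply]
        split_ifs
        · refine (hb hε (hF.fdiff t) (a - t)).trans (mul_le_mul_of_nonneg_left ?_ (by positivity))
          exact (abs_sub _ _).trans (add_le_add le_rfl (abs_le_of_mem_uIoc ht))
        · rw [abs_zero]; positivity
      · have hae : ∀ᵐ t : ℝ, t ≠ a := by
          have h := (measure_eq_zero_iff_ae_notMem (μ := (volume : Measure ℝ))).1 (Real.volume_singleton (a := a))
          filter_upwards [h] with t ht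
          simpa using ht
        filter_upwards [hae] with t hta ht
        rw [Set.uIoc_of_le ha.le, Set.mem_Ioc] at ht
        have ht' : t < a := lt_of_le_of_ne ht.2 hta
        have hlim := tendsto_Mfun r (hF.fdiff t) (a := a - t) (by linarith)
        refine hlim.congr' ?_
        filter_upwards [Ioo_mem_nhdsGT ht.1] with ε hε
        rw [Set.indicator_of_mem (Set.mem_Ioi.2 hε.2)]
    have key' := key.div_const a
    rw [Kfun_succ, peel]
    refine key'.congr' ?_
    filter_upwards [Ioo_mem_nhdsGT ha] with ε hε
    rw [Mfun_succ_eq_peelT hε.1 hF a r, peelT]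
    rw [max_eq_right hε.2.le, integral_eq_integral_indicator_Ioi hε.1.le hε.2.le]

/-! ### The limit of the truncated constants -/

/-- **`Σ_{r < R(ε)} Mfun ε r a F → I_a(F)`** as `ε → 0⁺` whenever `R(ε) → ∞`
(`a > 0`, `F` nice with nice derivative). [cite: Polymath8b2014, §4.5, pp. 18–19] -/
theorem tendsto_sum_Mfun (hF : NiceFun F D) {D' : ℝ} (hF' : NiceFun (deriv F) D') {a : ℝ} (ha : 0 < a)
    {R : ℝ → ℕ} (hR : Tendsto R (𝓝[>] 0) atTop) :
    Tendsto (fun ε => ∑ r ∈ Finset.range (R ε), Mfun ε r a F) (𝓝[>] 0) (𝓝 (Ifun a F)) := by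
  rw [Metric.tendsto_nhds]
  intro η hη
  -- choose `k₀` with `Σ_{r<k₀} K ≥ I - η/2`
  obtain ⟨k₀, hk₀⟩ := ((tendsto_sum_Kfun hF hF' ha.le).eventually (Metric.ball_mem_nhds _ (half_pos hη))).exists
  have hk₀' : |∑ r ∈ Finset.range k₀, Kfun r a F - Ifun a F| < η / 2 := by
    simpa [Metric.mem_ball, Real.dist_eq] using hk₀
  -- each `M^ε_r → K_r`, `r < k₀`
  have hδ : 0 < η / (2 * (k₀ + 1)) := by positivity
  have hM : ∀ᶠ ε in 𝓝[>] (0 : ℝ), ∀ r ∈ Finset.range k₀, |Mfun ε r a F - Kfun r a F| < η / (2 * (k₀ + 1)) := by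
    refine (Filter.eventually_all_finset _).2 fun r _ => ?_
    have h := (tendsto_Mfun r hF ha).eventually (Metric.ball_mem_nhds _ hδ)
    filter_upwards [h] with ε hε
    simpa [Metric.mem_ball, Real.dist_eq] using hε
  filter_upwards [hM, hR.eventually_ge_atTop k₀, self_mem_nhdsWithin] with ε hMε hRε (hε : 0 < ε)
  rw [Real.dist_eq, abs_lt]
  have hMK : ∀ r, 0 ≤ Mfun ε r a F ∧ Mfun ε r a F ≤ Kfun r a F := fun r => Mfun_nonneg_le_Kfun hε r hF ha.le
  -- upper bound
  have hup : ∑ r ∈ Finset.range (R ε), Mfun ε r a F ≤ Ifun a F :=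
    (Finset.sum_le_sum fun r _ => (hMK r).2).trans (sum_Kfun_le_Ifun hF ha.le _)
  -- lower bound
  have hlow : ∑ r ∈ Finset.range k₀, Kfun r a F - η / 2 ≤ ∑ r ∈ Finset.range (R ε), Mfun ε r a F := by
    have h1 : ∑ r ∈ Finset.range k₀, Mfun ε r a F ≤ ∑ r ∈ Finset.range (R ε), Mfun ε r a F :=
      Finset.sum_le_sum_of_subset_of_nonneg (Finset.range_subset_range.2 hRε) fun r _ _ => (hMK r).1
    have h2 : ∑ r ∈ Finset.range k₀, (Kfun r a F - η / (2 * (k₀ + 1))) ≤ ∑ r ∈ Finset.range k₀, Mfun ε r a F :=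
      Finset.sum_le_sum fun r hr => by have := hMε r hr; rw [abs_lt] at this; linarith
    rw [Finset.sum_sub_distrib, Finset.sum_const, Finset.card_range, nsmul_eq_mul] at h2
    have h3 : (k₀ : ℝ) * (η / (2 * (k₀ + 1))) ≤ η / 2 := by
      rw [mul_div_assoc', div_le_div_iff₀ (by positivity) (by positivity)]
      nlinarith
    linarith
  rw [abs_lt] at hk₀'
  constructor <;> linarith [hk₀'.1, hk₀'.2]

/-- The polarised truncated constant
`c''_ε(F, G) = (Σ_{r<R} Mfun ε r 1 (F+G) - Σ_{r<R} Mfun ε r 1 (F-G))/4`. [cite: Polymath8b2014, §4.5, p. 18] -/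
def cdeps (ε : ℝ) (R : ℕ) (F G : ℝ → ℝ) : ℝ :=
  (∑ r ∈ Finset.range R, Mfun ε r 1 (F + G) - ∑ r ∈ Finset.range R, Mfun ε r 1 (F - G)) / 4

/-- **The limit of the polarised constants**: `c''_ε(F,G) → ∫₀¹ F' G'` as `ε → 0⁺`, whenever
`R(ε) → ∞`. [cite: Polymath8b2014, §4.5, pp. 18–19, (condconv)–(depol)] -/
theorem tendsto_cdeps {G : ℝ → ℝ} {E D' E' : ℝ} (hF : NiceFun F D) (hF' : NiceFun (deriv F) D')
    (hG : NiceFun G E) (hG' : NiceFun (deriv G) E') {R : ℝ → ℕ} (hR : Tendsto R (𝓝[>] 0) atTop) :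
    Tendsto (fun ε => cdeps ε (R ε) F G) (𝓝[>] 0) (𝓝 (∫ t in (0 : ℝ)..1, deriv F t * deriv G t)) := by
  have hd1 : deriv (F + G) = deriv F + deriv G := by
    funext u; exact deriv_add hF.differentiable.differentiableAt hG.differentiable.differentiableAt
  have hd2 : deriv (F - G) = deriv F - deriv G := by
    funext u; exact deriv_sub hF.differentiable.differentiableAt hG.differentiable.differentiableAt
  have h1 := tendsto_sum_Mfun (hF.add hG) (D' := D' + E') (by rw [hd1]; exact hF'.add hG') one_pos hR
  have h2 := tendsto_sum_Mfun (hF.sub hG) (D' := D' + E') (by rw [hd2]; exact hF'.sub hG') one_pos hR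
  have h := (h1.sub h2).div_const 4
  refine h.congr' (Eventually.of_forall fun ε => rfl) |>.trans ?_
  -- identify the limit
  have e : (Ifun 1 (F + G) - Ifun 1 (F - G)) / 4 = ∫ t in (0 : ℝ)..1, deriv F t * deriv G t := by
    simp only [Ifun, hd1, hd2, Pi.add_apply, Pi.sub_apply]
    have i1 : IntervalIntegrable (fun t => (deriv F t + deriv G t) ^ 2) volume 0 1 :=
      ((hF.continuous_deriv.add hG.continuous_deriv).pow 2).intervalIntegrable _ _
    have i2 : IntervalIntegrable (fun t => (deriv F t - deriv G t) ^ 2) volume 0 1 :=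
      ((hF.continuous_deriv.sub hG.continuous_deriv).pow 2).intervalIntegrable _ _
    rw [← intervalIntegral.integral_sub i1 i2, ← intervalIntegral.integral_div]
    refine intervalIntegral.integral_congr fun t _ => ?_
    ring
  rw [e]

end Trunc

end Depol

end Literature.NumberTheory.Sieve
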